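import Mathlib.LinearAlgebra.BilinearForm.Properties
import Mathlib.LinearAlgebra.Trace
import Mathlib.Algebra.Lie.SkewAdjoint
import Literature.Algebra.Lie.GlIrreducibleSl2PowerCommutators
import Mathlib.Tactic.Module
import HarnessLib

/-!
# `𝔤𝔩(U) = 𝔤_-(U) ⊕ 𝔤_0(U) ⊕ 𝔤_+(U)` for a non-degenerate `ε`-symmetric form (Looijenga–Lunts 1997, Appendix, Lemma (7.5))

Topic `Literature/Algebra/Lie` (namespace `Literature.Algebra.Lie`).  Lane `lit-hodgefound` (Track 2 foundations
library), skeleton seat `lit-hodgefound-skel-1` (generations 48–49), row **A1-157** (§1–§3) and its riders **A1-161**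
(§4–§6), **A1-162** (§7) and **A1-163** (§8, the symplectic plane and the symplectic `4`-space) of
`run/shared/lean/pub/lit-hodgefound/SKELETON.md`: the "well-known" first statements of the third Lemma of
Looijenga–Lunts' Appendix — for a finite-dimensional space `U` with a non-degenerate `ε`-symmetric form, the
infinitesimal automorphisms are traceless (`𝔤_-(U) = 𝔞𝔲𝔱(U)`), `𝔤𝔩(U)` is the direct sum of the skew operators, the
scalars and the traceless self-adjoint operators, this decomposition is `𝔞𝔲𝔱(U)`-invariant, and
`[𝔤_+(U), 𝔤_+(U)] ⊂ 𝔤_-(U)` — with EQUALITY `[𝔤_+(U), 𝔤_+(U)] = 𝔤_-(U)` when `dim U > 2` (§4–§6).  THEOREMS ONLY in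
Mathlib's vocabulary (`LinearMap.BilinForm`, `IsSkewAdjoint` / `IsSelfAdjoint`, `skewAdjointSubmodule` /
`selfAdjointSubmodule`, `LinearMap.trace`, `DirectSum.IsInternal`, the ring commutator `⁅x, y⁆ = xy - yx` of
`Module.End K U`, the rank-one operators `(B x).smulRight y : w ↦ ⟨x, w⟩ y`); no definition, no named fact, no `sorry`
(D-0026 net debt `0`); no local instances.

## Source, VERBATIM

E. Looijenga, V. A. Lunts, *A Lie algebra attached to a projective variety*, Invent. Math. **129** (1997) 361–412,
Appendix (held TeX text `paper:arxiv-alg-geom_9604014`, p0028 L80–L98; numbered (7.5) in the held PDF text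
`paper:arxiv-alg-geom-9604014`, p0066 L3–L7):

> "Let `U` be vector space of finite dimension `≥ 2` with a nondegenerate `ε`-symmetric form and denote its Lie
> algebra of infinitesimal automorphisms by `𝔞𝔲𝔱(U)`. Let `𝔤_±(U)` be the set of `x ∈ 𝔰𝔩(U)` satisfying
> `⟨xu, u'⟩ = ±⟨u, xu'⟩` and let `𝔤_0(U)` denote the scalar operators in `𝔤𝔩(U)`.
> (7.5) Lemma. Suppose that `U` is not an inner product space of dimension two. Then `𝔤𝔩_-(U) = 𝔞𝔲𝔱(U)` and
> `𝔤𝔩(U) = 𝔤_-(U) ⊕ 𝔤_0(U) ⊕ 𝔤_+(U)` is an `𝔞𝔲𝔱(U)`-invariant decomposition. The summands are irreducible, except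
> when `U` is an inner product space of dimension `4`. If `dim U > 2`, then `[𝔤_+(U), 𝔤_+(U)] = 𝔤_-(U)` and for `ε = ±`,
> there exists `Y ∈ 𝔤_ε(U)` such that `Y² ∈ 𝔤_+(U) + 𝔤_0(U)` is not a scalar and has nonzero trace.
> Proof. The first statements are well-known. If `dim U > 2`, then `[𝔤_+(U), 𝔤_+(U)]` is a nontrivial subspace of
> `𝔤_-(U)` and hence equal to it (since `𝔤_-(U)` is irreducible). The last statement is an easy exercise."

## Rendering (dictionary)

* "nondegenerate `ε`-symmetric form": a bilinear form `B : LinearMap.BilinForm K U`, `B.Nondegenerate`, with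
  `⟨u', u⟩ = ε ⟨u, u'⟩` for a scalar `ε` with `ε² = 1` (`hflip`, `hε`; `ε = 1`: symmetric / "inner product space",
  `ε = -1`: symplectic).  The field: the paper works over `ℂ`; here any field of characteristic `0` (`≠ 2` suffices for
  §1 and the bracket relations).
* "`𝔞𝔲𝔱(U)`", "`⟨xu, u'⟩ = -⟨u, xu'⟩`": Mathlib `B.IsSkewAdjoint x`, the subspace `B.skewAdjointSubmodule`;
  "`⟨xu, u'⟩ = +⟨u, xu'⟩`": `B.IsSelfAdjoint x`, `B.selfAdjointSubmodule`; "`𝔰𝔩(U)`": `LinearMap.ker (LinearMap.trace K U)`;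
  so `𝔤_-(U) = B.skewAdjointSubmodule ⊓ ker tr`, `𝔤_+(U) = B.selfAdjointSubmodule ⊓ ker tr`, and "`𝔤_0(U)`, the scalar
  operators" `= K ∙ 1` — all written inline (no new definitions).
* "`𝔤𝔩_-(U) = 𝔞𝔲𝔱(U)`" [sic, for `𝔤_-(U)`]: `B.skewAdjointSubmodule ≤ ker tr` (`skewAdjointSubmodule_le_ker_trace`), i.e.
  `B.skewAdjointSubmodule ⊓ ker tr = B.skewAdjointSubmodule`; accordingly the decomposition is stated with
  `B.skewAdjointSubmodule` as its first summand.
* "`𝔤𝔩(U) = 𝔤_-(U) ⊕ 𝔤_0(U) ⊕ 𝔤_+(U)`": `DirectSum.IsInternal ![𝔞𝔲𝔱, K ∙ 1, sym ∩ 𝔰𝔩]` (a `Fin 3`-indexed internal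
  direct sum of subspaces of `Module.End K U`).
* "`𝔞𝔲𝔱(U)`-invariant": each summand is stable under `x ↦ [a, x] = ax - xa`, `a ∈ 𝔞𝔲𝔱(U)` (the commutator bracket
  `Ring.instBracket` of `𝔤𝔩(U)`); "`[𝔤_+(U), 𝔤_+(U)] ⊂ 𝔤_-(U)`": brackets of elements of `𝔤_+(U)` lie in `𝔤_-(U)`;
  "`[𝔤_+(U), 𝔤_+(U)] = 𝔤_-(U)`": the `K`-linear span `Submodule.span K {[x, y] | x, y ∈ 𝔤_+(U)}` equals
  `B.skewAdjointSubmodule` (`= 𝔤_-(U)` by §1); "`dim U > 2`": `3 ≤ finrank K U`.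
* The adjoint `X ↦ X^*` (`⟨X^* u, u'⟩ = ⟨u, X u'⟩`, Mathlib `B.leftAdjointOfNondegenerate`) packaged as a linear
  anti-involution `τ` of `𝔤𝔩(U)` with `tr (τ X) = tr X` — the tool of the proofs (`X_∓ = ½(X ∓ X^*)`).

## Contents (all proved)

* §1 **`exists_adjoint_antiInvolution_of_flip`** (`τ`: adjointness, `τ(XY) = τY τX`, `τ² = 1`, `tr ∘ τ = tr` — `τ X` is
  the transpose conjugated by `U ≅ U^*`, Mathlib `LinearMap.trace_conj'` + `trace_transpose'` —, `τ X = ∓X` iff `X` is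
  skew / self-adjoint); **`trace_eq_zero_of_isSkewAdjoint`**, **`skewAdjointSubmodule_le_ker_trace`**,
  `skewAdjointSubmodule_inf_ker_trace` ("`𝔤𝔩_-(U) = 𝔞𝔲𝔱(U)`").
* §2 `eq_zero_of_isSkewAdjoint_of_isSelfAdjoint` (`𝔤_- ∩ 𝔤_+ = 0`), `isSelfAdjoint_smul_one`,
  **`exists_skew_add_scalar_add_symm`** (`X = X_- + X_0 + X_+`), `skew_sup_scalar_sup_symm_eq_top`, the three
  disjointness lemmas `disjoint_skew_scalar_sup_symm`, `disjoint_scalar_skew_sup_symm`, `disjoint_symm_skew_sup_scalar`,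
  and **`isInternal_skew_scalar_symm`**: `𝔤𝔩(U) = 𝔤_-(U) ⊕ 𝔤_0(U) ⊕ 𝔤_+(U)`.
* §3 `isSelfAdjoint_bracket_of_isSkewAdjoint_of_isSelfAdjoint` (the companion "`[sym, sym]` is skew" is A1-155's
  `isSkewAdjoint_bracket_of_isSelfAdjoint`, imported), and the invariance of the three summands under `𝔞𝔲𝔱(U)`: `lie_mem_skewAdjointSubmodule` (Mathlib `isSkewAdjoint_bracket`),
  `lie_mem_span_one`, **`lie_mem_selfAdjointSubmodule_inf_ker_trace`**; **`lie_mem_skewAdjointSubmodule_of_mem_selfAdjointSubmodule`**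
  (`[𝔤_+(U), 𝔤_+(U)] ⊂ 𝔤_-(U)`).
* §4 (rider A1-161, `ε = 1`) the rank-`≤ 2` operators `t_{x,y} = (B x).smulRight y`:
  `isSelfAdjoint_smulRight_add_smulRight` / `isSkewAdjoint_smulRight_sub_smulRight` (`s_{x,y} = t_{x,y} + t_{y,x}`
  self-adjoint, `r_{x,y} = t_{x,y} - t_{y,x}` skew), `trace_smulRight_add_smulRight` (`tr s_{x,y} = 2⟨x, y⟩`),
  `smulRight_add_smulRight_mem` (`s_{x,y} ∈ 𝔤_+(U)` for `x ⊥ y`), **`lie_smulRight_add_smulRight`**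
  (`[s_{u,w}, s_{w,v}] = ⟨w, w⟩ r_{v,u}` for `w ⊥ u, v`), **`skewAdjointSubmodule_le_span_lie_of_symm`**,
  **`span_lie_selfAdjoint_eq_skewAdjointSubmodule_of_symm`**; private folklore helpers `smulRight_mul_smulRight`
  (`t_{x,y} t_{x',y'} = ⟨x, y'⟩ t_{x',y}`), the linearity of `r_{x,·}`, and `two_smul_eq_sum_smulRight_sub_of_isSkewAdjoint`
  (`2X = Σ_i ⟨e_i, e_i⟩⁻¹ r_{e_i, X e_i}` in an orthogonal basis, Mathlib `LinearMap.BilinForm.exists_orthogonal_basis`).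
* §5 (`ε = -1`) `isSelfAdjoint_smulRight_sub_smulRight` (`a_{x,y} = t_{x,y} - t_{y,x}` self-adjoint),
  `isSkewAdjoint_smulRight_self` (`t_{w,w} ∈ 𝔰𝔭(U)`), **`lie_smulRight_sub_smulRight`** (`[a_{u,w}, a_{w,v}] = 2⟨u, v⟩ t_{w,w}`),
  `trace_smulRight_sub_smulRight`, `smulRight_sub_smulRight_mem`, `smulRight_self_mem_span_lie_of_alt`
  (`t_{w,w} ∈ [𝔤_+(U), 𝔤_+(U)]`), **`skewAdjointSubmodule_le_span_lie_of_alt`**,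
  **`span_lie_selfAdjoint_eq_skewAdjointSubmodule_of_alt`**; private folklore helpers: polarisation
  `t_{x,y} + t_{y,x} = t_{x+y,x+y} - t_{x,x} - t_{y,y}`, dual pairs of families `Σ_i t_{f_i,e_i} = 1` (via `B.toDual`),
  `two_smul_eq_sum_smulRight_add_of_isSkewAdjoint` (`2X = Σ_i (t_{f_i, X e_i} + t_{X e_i, f_i})`), and
  `exists_orthogonal_pair_of_alt` (`dim U ≥ 3 ⇒` every `w` has `u, v ⊥ w` with `⟨u, v⟩ ≠ 0`: a totally isotropic
  subspace has at most half the dimension, Mathlib `LinearMap.BilinForm.finrank_add_finrank_orthogonal`).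
* §6 **`span_lie_selfAdjoint_eq_skewAdjointSubmodule`** (`ε² = 1 ⇒ ε = ±1`): "If `dim U > 2`, then
  `[𝔤_+(U), 𝔤_+(U)] = 𝔤_-(U)`", and `span_lie_selfAdjoint_eq_skewAdjointSubmodule_inf_ker_trace` (with `𝔤_-(U)`
  written `𝔞𝔲𝔱(U) ∩ 𝔰𝔩(U)`).
* §7 (rider A1-162) the last clause "there exists `Y ∈ 𝔤_ε(U)` such that `Y² ∈ 𝔤_+(U) + 𝔤_0(U)` is not a scalar
  and has nonzero trace": `isSelfAdjoint_mul_self_of_isSelfAdjoint` / `…_of_isSkewAdjoint` (`Y²` is self-adjoint),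
  `isSkewAdjoint_smulRight_add_smulRight_of_alt`, **`exists_skewAdjoint_sq_not_mem_span_one_of_symm`** /
  **`exists_selfAdjoint_sq_not_mem_span_one_of_symm`** (inner product spaces, `dim ≥ 3`, `Y = r_{e₀,e₁}` /
  `s_{e₀,e₁}`), **`exists_skewAdjoint_sq_not_mem_span_one_of_alt`** (symplectic, `dim ≥ 3`, `Y = t_{e,f} + t_{f,e}`
  for a hyperbolic pair), **`exists_selfAdjoint_sq_not_mem_span_one_of_alt`** (symplectic, `dim ≥ 5`,
  `Y = P₁ - P₂`), and the `ε`-symmetric forms **`exists_skewAdjoint_sq_not_mem_span_one`** (`dim ≥ 3`) and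
  **`exists_selfAdjoint_sq_not_mem_span_one`** (`dim ≥ 5`).
* §8 (rider A1-163) the two small symplectic cases, where the self-adjoint operators are governed by the block form
  `W = [A G; F Aᵀ]` (`G`, `F` antisymmetric) of an `ω`-self-adjoint ("skew-Hamiltonian") matrix
  [LiuZhangFerreiraRalha2012, Def. 2.8 (2)]: **`isSelfAdjoint_iff_mem_span_one_of_alt_finrank_two`** (symplectic
  plane: the self-adjoint operators are the scalars), **`selfAdjointSubmodule_inf_ker_trace_eq_bot_of_alt_finrank_two`**
  (`𝔤_+(U) = 0`); **`exists_mul_self_eq_smul_add_smul_one_of_isSelfAdjoint_of_alt_finrank_four`** (symplectic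
  `4`-space: `Y² = a Y + c · 1` with `2a = tr Y` for every self-adjoint `Y`),
  `mul_self_sub_smul_mem_span_one_of_isSelfAdjoint_of_alt_finrank_four`,
  **`mul_self_mem_span_one_of_mem_selfAdjointSubmodule_inf_ker_trace_of_alt_finrank_four`** (every `Y ∈ 𝔤_+(U)`
  has a SCALAR square), **`not_exists_selfAdjoint_sq_not_mem_span_one_of_alt_finrank_four`** (the printed last
  clause of (7.5) FAILS for `ε = +`, `U` symplectic of dimension `4`), and the Clifford relations
  `mul_add_mul_mem_span_one_of_mem_selfAdjointSubmodule_inf_ker_trace_of_alt_finrank_four` (`YZ + ZY ∈ K · 1`);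
  private: two orthogonal hyperbolic pairs exist and span (`P₁ + P₂ = 1`, via `basisOfLinearIndependentOfCardEqFinrank`),
  and the coordinate identity `Y² = (α + β) Y + (ps - qr - αβ) · 1`, `tr Y = 2(α + β)`.

## SCOPE (not formalised here)

(a) The hypotheses "`dim U ≥ 2`" / "not an inner product space of dimension two" are not needed for the statements
proved in §1–§3 and are not assumed; §4–§6 assume `3 ≤ finrank K U` ("`dim U > 2`") and characteristic `0` (the
paper: `K = ℂ`).  (b) NOT formalised: "The summands are irreducible, except when `U` is an inner product space of
dimension `4`".  The EQUALITY `[𝔤_+(U), 𝔤_+(U)] = 𝔤_-(U)` IS proved (§4–§6), by elementary rank-two operators rather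
than by the printed irreducibility of `𝔤_-(U)` (a deliberate, shorter road; the statement is the printed one).  The
last clause ("there exists `Y ∈ 𝔤_ε(U)` …", "an easy exercise") is proved in §7 for `Y ∈ 𝔤_-(U)` in dimension `≥ 3`
(both kinds of form) and for `Y ∈ 𝔤_+(U)` in dimension `≥ 3` (inner product spaces) resp. `≥ 5` (symplectic spaces);
CORRECTION (§8, PROVED): for a SYMPLECTIC `U` OF DIMENSION `4` and `Y ∈ 𝔤_+(U)` the printed clause (stated for
`dim U > 2`) is FALSE — every traceless self-adjoint `Y` then has a scalar square
(`mul_self_mem_span_one_of_mem_selfAdjointSubmodule_inf_ker_trace_of_alt_finrank_four`,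
`not_exists_selfAdjoint_sq_not_mem_span_one_of_alt_finrank_four`; `𝔤_+(U) ≅ Λ²₀U` is the `5`-dimensional
representation of `𝔰𝔭(4) ≅ 𝔰𝔬(5)` — that isomorphism itself is NOT formalised, only the relations `Y² ∈ K · 1`,
`YZ + ZY ∈ K · 1`); for the symplectic PLANE (`dim U = 2`, allowed by the paper's "`dim U ≥ 2`") `𝔤_+(U) = 0` (§8).
(c) The rest of the
Appendix ((7.3)–(7.4) Dynkin, (7.6)–(7.8)) is out of scope; (7.1)–(7.2) are rows A1-153∕154∕155.  (d) Nothing here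
concerns complex tori or the Hodge conjecture.

## References

* [LooijengaLunts1997] E. Looijenga, V. A. Lunts, *A Lie algebra attached to a projective variety*, Invent. Math. 129
  (1997) 361–412; arXiv:alg-geom/9604014. Appendix, Lemma (7.5) and the paragraph before it, p. 28 L80–L98 of the
  held TeX text (`paper:arxiv-alg-geom_9604014`); p0066 of the held PDF text (`paper:arxiv-alg-geom-9604014`).
* [LiuZhangFerreiraRalha2012] Z. Liu, Y. Zhang, C. Ferreira, R. Ralha, *Structure-preserving Schur methods for computing
  square roots of real skew-Hamiltonian matrices*, Electron. J. Linear Algebra 23 (2012) 845–865; arXiv:1201.5055.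
  Definition 2.8 (2), p. 5 of the held text (`paper:arxiv-1201.5055`, p0005 L43–L59): "A matrix `W ∈ ℝ^{2n×2n}` is
  said to be skew-Hamiltonian if `WJ = -(WJ)^T`. Likewise, `W` can be partitioned as `W = [A G; F A^T]`,
  `G = -G^T`, `F = -F^T`, `A, G, F ∈ ℝ^{n×n}`. […] the eigenvalues of `W` have even algebraic and geometric
  multiplicities." (used for §8: `WJ = -(WJ)^T` says `W` is self-adjoint for the symplectic form `J`; the cases
  `n = 1, 2`).
-/

namespace Literature.Algebra.Lie

open Module Function Set
open LinearMap (BilinForm)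

/-! ### §1 The adjoint anti-involution `τ` of a non-degenerate `ε`-symmetric form, and `tr(τ X) = tr X` -/

section Adjoint

variable {K : Type*} [Field K] {U : Type*} [AddCommGroup U] [Module K U] [FiniteDimensional K U]

/-- **The adjoint `X ↦ X^*` of a non-degenerate `ε`-symmetric form (`⟨u', u⟩ = ε⟨u, u'⟩`, `ε² = 1`) as a linear
anti-involution of `𝔤𝔩(U)` preserving the trace**: `⟨X^* u, u'⟩ = ⟨u, X u'⟩`, `(XY)^* = Y^* X^*`, `X^{**} = X`,
`tr X^* = tr X` (`X^*` is conjugate to the transpose `Xᵗ` by `U ≅ U^*`), and `X^* = -X` (resp. `= X`) iff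
`⟨X u, u'⟩ = -⟨u, X u'⟩` (resp. `= +⟨u, X u'⟩`) — the data behind "`𝔤_±(U)` … the set of `x ∈ 𝔰𝔩(U)` satisfying
`⟨xu, u'⟩ = ±⟨u, xu'⟩`".  (`X^*` is Mathlib's `B.leftAdjointOfNondegenerate`; compare the antisymmetric special case
`QuaternionCentralizerForm.exists_adjoint_antiInvolution` of the tree.) [cite: LooijengaLunts1997, Appendix (7.5), p. 28 L80–L89] -/
theorem exists_adjoint_antiInvolution_of_flip (B : BilinForm K U) (hB : B.Nondegenerate) {ε : K}
    (hflip : ∀ u u' : U, B u' u = ε * B u u') (hε : ε * ε = 1) :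
    ∃ τ : Module.End K U →ₗ[K] Module.End K U,
      (∀ X u u', B (τ X u) u' = B u (X u')) ∧ (∀ X Y, τ (X * Y) = τ Y * τ X) ∧ (∀ X, τ (τ X) = X) ∧
      (∀ X, LinearMap.trace K U (τ X) = LinearMap.trace K U X) ∧
      (∀ X, τ X = -X ↔ B.IsSkewAdjoint X) ∧ (∀ X, τ X = X ↔ B.IsSelfAdjoint X) := by
  have hadj : ∀ (X : Module.End K U) (x y : U), B (B.leftAdjointOfNondegenerate hB X x) y = B x (X y) :=
    fun X x y ↦ B.isAdjointPairLeftAdjointOfNondegenerate hB X x y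
  have huniq : ∀ X Y : Module.End K U, (∀ x y, B (Y x) y = B x (X y)) → Y = B.leftAdjointOfNondegenerate hB X :=
    fun X Y h ↦ (B.isAdjointPair_iff_eq_of_nondegenerate hB Y X).1 h
  let τ : Module.End K U →ₗ[K] Module.End K U :=
    { toFun := B.leftAdjointOfNondegenerate hB
      map_add' := fun X Y ↦ (huniq _ _ fun x y ↦ by
        simp only [LinearMap.add_apply, map_add, hadj]).symm
      map_smul' := fun c X ↦ (huniq _ _ fun x y ↦ by
        simp only [RingHom.id_apply, LinearMap.smul_apply, map_smul, hadj]).symm }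
  have hτ : ∀ X, τ X = B.leftAdjointOfNondegenerate hB X := fun _ ↦ rfl
  have hτadj : ∀ X x y, B (τ X x) y = B x (X y) := fun X x y ↦ hadj X x y
  -- `τ X` is the transpose conjugated by `U ≅ U^*`: hence `tr (τ X) = tr X`
  have hconj : ∀ X, τ X = (B.toDual hB).symm.conj (Module.Dual.transpose (R := K) X) := by
    intro X
    rw [hτ]
    refine (huniq _ _ fun x y ↦ ?_).symm
    rw [LinearEquiv.conj_apply, LinearEquiv.symm_symm, LinearMap.comp_apply, LinearMap.comp_apply,
      LinearEquiv.coe_coe, LinearEquiv.coe_coe, ← LinearMap.BilinForm.toDual_def hB, LinearEquiv.apply_symm_apply,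
      Module.Dual.transpose_apply, LinearMap.comp_apply, LinearMap.BilinForm.toDual_def]
  refine ⟨τ, hτadj, fun X Y ↦ ?_, fun X ↦ ?_, fun X ↦ ?_, fun X ↦ ?_, fun X ↦ ?_⟩
  · rw [hτ (X * Y)]
    exact (huniq _ _ fun x y ↦ by simp only [Module.End.mul_apply, hτadj]).symm
  · rw [hτ (τ X)]
    refine (huniq _ _ fun x y ↦ ?_).symm
    rw [hflip (τ X y) x, hτadj, hflip (X x) y, ← mul_assoc, hε, one_mul]
  · rw [hconj, LinearMap.trace_conj', LinearMap.trace_transpose']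
  · constructor
    · intro h x y
      rw [Pi.neg_apply, map_neg, ← hτadj X x y, h, LinearMap.neg_apply, map_neg, LinearMap.neg_apply, neg_neg]
    · intro h
      rw [hτ]
      refine (huniq X (-X) fun x y ↦ ?_).symm
      have h2 := h x y
      rw [Pi.neg_apply, map_neg] at h2
      rw [LinearMap.neg_apply, map_neg, LinearMap.neg_apply, h2, neg_neg]
  · constructor
    · intro h x y
      rw [← hτadj X x y, h]
    · intro h
      rw [hτ]
      exact (huniq X X fun x y ↦ h x y).symm

/-- **"`𝔤𝔩_-(U) = 𝔞𝔲𝔱(U)`": an infinitesimal automorphism of a non-degenerate `ε`-symmetric form is traceless**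
(`X^* = -X` and `tr X^* = tr X` give `2 tr X = 0`; characteristic `≠ 2`). [cite: LooijengaLunts1997, Appendix Lemma (7.5), p. 28 L87–L88] -/
theorem trace_eq_zero_of_isSkewAdjoint [NeZero (2 : K)] {B : BilinForm K U} (hB : B.Nondegenerate) {ε : K}
    (hflip : ∀ u u' : U, B u' u = ε * B u u') (hε : ε * ε = 1) {X : Module.End K U} (hX : B.IsSkewAdjoint X) :
    LinearMap.trace K U X = 0 := by
  obtain ⟨τ, -, -, -, htr, hskew, -⟩ := exists_adjoint_antiInvolution_of_flip B hB hflip hε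
  have h1 := htr X
  rw [(hskew X).2 hX, map_neg] at h1
  have h2 : (2 : K) * LinearMap.trace K U X = 0 := by linear_combination (-1 : K) * h1
  exact (mul_eq_zero.1 h2).resolve_left (NeZero.ne 2)

/-- **"`𝔤𝔩_-(U) = 𝔞𝔲𝔱(U)`"**: `𝔤_-(U)`, "the set of `x ∈ 𝔰𝔩(U)` satisfying `⟨xu, u'⟩ = -⟨u, xu'⟩`", is ALL of
`𝔞𝔲𝔱(U) = {x ∈ 𝔤𝔩(U) | ⟨xu, u'⟩ = -⟨u, xu'⟩}` (Mathlib `B.skewAdjointSubmodule`): `𝔞𝔲𝔱(U) ⊆ 𝔰𝔩(U)`.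
[cite: LooijengaLunts1997, Appendix Lemma (7.5), p. 28 L82–L88] -/
theorem skewAdjointSubmodule_le_ker_trace [NeZero (2 : K)] {B : BilinForm K U} (hB : B.Nondegenerate) {ε : K}
    (hflip : ∀ u u' : U, B u' u = ε * B u u') (hε : ε * ε = 1) :
    B.skewAdjointSubmodule ≤ LinearMap.ker (LinearMap.trace K U) := fun _ hX ↦
  LinearMap.mem_ker.2 (trace_eq_zero_of_isSkewAdjoint hB hflip hε ((LinearMap.mem_skewAdjointSubmodule _).1 hX))

/-- … as the printed equality `𝔤_-(U) = 𝔞𝔲𝔱(U) ∩ 𝔰𝔩(U) = 𝔞𝔲𝔱(U)`. [cite: LooijengaLunts1997, Appendix Lemma (7.5), p. 28 L87–L88] -/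
theorem skewAdjointSubmodule_inf_ker_trace [NeZero (2 : K)] {B : BilinForm K U} (hB : B.Nondegenerate) {ε : K}
    (hflip : ∀ u u' : U, B u' u = ε * B u u') (hε : ε * ε = 1) :
    B.skewAdjointSubmodule ⊓ LinearMap.ker (LinearMap.trace K U) = B.skewAdjointSubmodule :=
  inf_eq_left.2 (skewAdjointSubmodule_le_ker_trace hB hflip hε)

end Adjoint

/-! ### §2 `𝔤𝔩(U) = 𝔤_-(U) ⊕ 𝔤_0(U) ⊕ 𝔤_+(U)` -/

section Decomposition

variable {K : Type*} [Field K] {U : Type*} [AddCommGroup U] [Module K U] [FiniteDimensional K U]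
  {B : BilinForm K U}

omit [FiniteDimensional K U] in
/-- An operator which is both skew and self-adjoint for a non-degenerate form vanishes (characteristic `≠ 2`):
`𝔤_-(U) ∩ 𝔤_+(U) = 0`. [cite: LooijengaLunts1997, Appendix Lemma (7.5), p. 28 L88–L89] -/
theorem eq_zero_of_isSkewAdjoint_of_isSelfAdjoint [NeZero (2 : K)] (hB : B.Nondegenerate) {X : Module.End K U}
    (h1 : B.IsSkewAdjoint X) (h2 : B.IsSelfAdjoint X) : X = 0 := by
  refine LinearMap.ext fun u ↦ hB.1 _ fun u' ↦ ?_
  have h3 := h1 u u'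
  rw [Pi.neg_apply, map_neg, ← h2 u u'] at h3
  have h4 : (2 : K) * B (X u) u' = 0 := by linear_combination h3
  exact (mul_eq_zero.1 h4).resolve_left (NeZero.ne 2)

omit [FiniteDimensional K U] in
/-- The identity is self-adjoint; so are the scalars `𝔤_0(U)`. [cite: LooijengaLunts1997, Appendix Lemma (7.5), p. 28 L83–L85] -/
theorem isSelfAdjoint_smul_one (B : BilinForm K U) (c : K) : B.IsSelfAdjoint ⇑(c • (1 : Module.End K U)) := by
  intro u u'
  rw [LinearMap.smul_apply, LinearMap.smul_apply, Module.End.one_apply, Module.End.one_apply, map_smul,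
    LinearMap.smul_apply, map_smul]

/-- `tr (c · 1) = c · dim U`. [folklore] -/
private theorem trace_smul_one (c : K) :
    LinearMap.trace K U (c • (1 : Module.End K U)) = c * (Module.finrank K U : K) := by
  rw [map_smul, LinearMap.trace_one, smul_eq_mul]

variable [CharZero K]

/-- **The decomposition `X = X_- + X_0 + X_+`**: for a non-degenerate `ε`-symmetric form (`ε² = 1`) every `X ∈ 𝔤𝔩(U)`
is the sum of a skew `X_- = ½(X - X^*)`, a scalar `X_0 = (tr X / dim U) · 1` and a traceless self-adjoint
`X_+ = ½(X + X^*) - X_0` operator (characteristic `0`). [cite: LooijengaLunts1997, Appendix Lemma (7.5), p. 28 L87–L89] -/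
theorem exists_skew_add_scalar_add_symm (hB : B.Nondegenerate) {ε : K} (hflip : ∀ u u' : U, B u' u = ε * B u u')
    (hε : ε * ε = 1) (X : Module.End K U) :
    ∃ Xm ∈ B.skewAdjointSubmodule, ∃ c : K, ∃ Xp ∈ B.selfAdjointSubmodule ⊓ LinearMap.ker (LinearMap.trace K U),
      X = Xm + c • (1 : Module.End K U) + Xp := by
  obtain ⟨τ, -, -, hττ, htr, hskew, hsymm⟩ := exists_adjoint_antiInvolution_of_flip B hB hflip hε
  set c : K := LinearMap.trace K U X / (Module.finrank K U : K) with hc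
  refine ⟨(2 : K)⁻¹ • (X - τ X), ?_, c, (2 : K)⁻¹ • (X + τ X) - c • 1, Submodule.mem_inf.2 ⟨?_, ?_⟩, ?_⟩
  · rw [LinearMap.mem_skewAdjointSubmodule, ← hskew, map_smul, map_sub, hττ, smul_sub, smul_sub, neg_sub]
  · rw [LinearMap.mem_selfAdjointSubmodule]
    have h1 : τ ((2 : K)⁻¹ • (X + τ X) - c • 1) = (2 : K)⁻¹ • (X + τ X) - c • 1 := by
      rw [map_sub, map_smul, map_add, hττ, add_comm (τ X) X, (hsymm _).2 (isSelfAdjoint_smul_one B c)]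
    exact (hsymm _).1 h1
  · rw [LinearMap.mem_ker, map_sub, map_smul, map_add, htr, trace_smul_one, hc, smul_eq_mul]
    rcases eq_or_ne (Module.finrank K U : K) 0 with h0 | h0
    · -- `U = 0`: every operator is `0`
      have hU : Module.finrank K U = 0 := by exact_mod_cast h0
      haveI : Subsingleton U := Module.finrank_zero_iff.1 hU
      have hX : X = 0 := Subsingleton.elim _ _
      rw [hX, map_zero, add_zero, mul_zero, zero_div, zero_mul, sub_zero]
    · rw [div_mul_cancel₀ _ h0]; ring
  · have h2 : (2 : K)⁻¹ • (X - τ X) + c • (1 : Module.End K U) + ((2 : K)⁻¹ • (X + τ X) - c • 1) =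
        ((2 : K)⁻¹ + (2 : K)⁻¹) • X := by
      rw [smul_sub, smul_add, add_smul]; abel
    rw [h2, ← two_mul, mul_inv_cancel₀ (two_ne_zero' K), one_smul]

/-- `𝔤_-(U) + 𝔤_0(U) + 𝔤_+(U) = 𝔤𝔩(U)`. [cite: LooijengaLunts1997, Appendix Lemma (7.5), p. 28 L87–L89] -/
theorem skew_sup_scalar_sup_symm_eq_top (hB : B.Nondegenerate) {ε : K} (hflip : ∀ u u' : U, B u' u = ε * B u u')
    (hε : ε * ε = 1) :
    B.skewAdjointSubmodule ⊔ (K ∙ (1 : Module.End K U)) ⊔ (B.selfAdjointSubmodule ⊓ LinearMap.ker (LinearMap.trace K U)) = ⊤ := by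
  rw [eq_top_iff]
  intro X _
  obtain ⟨Xm, hXm, c, Xp, hXp, rfl⟩ := exists_skew_add_scalar_add_symm hB hflip hε X
  exact Submodule.add_mem _ (Submodule.mem_sup_left (Submodule.add_mem _ (Submodule.mem_sup_left hXm)
    (Submodule.mem_sup_right (Submodule.smul_mem _ c (Submodule.mem_span_singleton_self _))))) (Submodule.mem_sup_right hXp)

omit [FiniteDimensional K U] in
/-- `𝔤_-(U) ∩ (𝔤_0(U) + 𝔤_+(U)) = 0` (a skew operator which is also self-adjoint vanishes).
[cite: LooijengaLunts1997, Appendix Lemma (7.5), p. 28 L87–L89] -/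
theorem disjoint_skew_scalar_sup_symm (hB : B.Nondegenerate) :
    Disjoint B.skewAdjointSubmodule ((K ∙ (1 : Module.End K U)) ⊔ (B.selfAdjointSubmodule ⊓ LinearMap.ker (LinearMap.trace K U))) := by
  rw [Submodule.disjoint_def]
  intro X hX hX'
  obtain ⟨Y, hY, Z, hZ, rfl⟩ := Submodule.mem_sup.1 hX'
  obtain ⟨c, rfl⟩ := Submodule.mem_span_singleton.1 hY
  refine eq_zero_of_isSkewAdjoint_of_isSelfAdjoint hB ((LinearMap.mem_skewAdjointSubmodule _).1 hX) fun u u' ↦ ?_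
  have h1 := (LinearMap.mem_selfAdjointSubmodule _).1 hZ.1 u u'
  have h2 := isSelfAdjoint_smul_one B c u u'
  simp only [LinearMap.add_apply, map_add] at h1 h2 ⊢
  rw [h1, h2]

/-- `𝔤_0(U) ∩ (𝔤_-(U) + 𝔤_+(U)) = 0` (both summands are traceless, `tr (c · 1) = c dim U`).
[cite: LooijengaLunts1997, Appendix Lemma (7.5), p. 28 L87–L89] -/
theorem disjoint_scalar_skew_sup_symm (hB : B.Nondegenerate) {ε : K} (hflip : ∀ u u' : U, B u' u = ε * B u u')
    (hε : ε * ε = 1) :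
    Disjoint (K ∙ (1 : Module.End K U)) (B.skewAdjointSubmodule ⊔ (B.selfAdjointSubmodule ⊓ LinearMap.ker (LinearMap.trace K U))) := by
  rw [Submodule.disjoint_def]
  intro X hX hX'
  obtain ⟨c, rfl⟩ := Submodule.mem_span_singleton.1 hX
  have htr : LinearMap.trace K U (c • (1 : Module.End K U)) = 0 := by
    obtain ⟨Y, hY, Z, hZ, hYZ⟩ := Submodule.mem_sup.1 hX'
    rw [← hYZ, map_add, LinearMap.mem_ker.1 (skewAdjointSubmodule_le_ker_trace hB hflip hε hY),
      LinearMap.mem_ker.1 hZ.2, add_zero]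
  rw [trace_smul_one] at htr
  rcases mul_eq_zero.1 htr with h0 | h0
  · rw [h0, zero_smul]
  · haveI : Subsingleton U := Module.finrank_zero_iff.1 (by exact_mod_cast h0)
    exact Subsingleton.elim _ _

/-- `𝔤_+(U) ∩ (𝔤_-(U) + 𝔤_0(U)) = 0`. [cite: LooijengaLunts1997, Appendix Lemma (7.5), p. 28 L87–L89] -/
theorem disjoint_symm_skew_sup_scalar (hB : B.Nondegenerate) :
    Disjoint (B.selfAdjointSubmodule ⊓ LinearMap.ker (LinearMap.trace K U)) (B.skewAdjointSubmodule ⊔ (K ∙ (1 : Module.End K U))) := by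
  rw [Submodule.disjoint_def]
  rintro X ⟨hXs, hXt⟩ hX'
  obtain ⟨Y, hY, Z, hZ, hYZ⟩ := Submodule.mem_sup.1 hX'
  obtain ⟨c, rfl⟩ := Submodule.mem_span_singleton.1 hZ
  -- `Y = X - c 1` is skew and self-adjoint, hence `0`; then `X = c 1` is traceless, so `c = 0` (or `U = 0`)
  have hY0 : Y = 0 := by
    refine eq_zero_of_isSkewAdjoint_of_isSelfAdjoint hB ((LinearMap.mem_skewAdjointSubmodule _).1 hY) ?_
    have hYX : Y = X - c • 1 := by rw [← hYZ, add_sub_cancel_right]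
    rw [hYX]
    intro u u'
    have h1 := (LinearMap.mem_selfAdjointSubmodule _).1 hXs u u'
    have h2 := isSelfAdjoint_smul_one B c u u'
    simp only [LinearMap.sub_apply, map_sub] at h1 h2 ⊢
    rw [h1, h2]
  rw [hY0, zero_add] at hYZ
  rw [← hYZ] at hXt ⊢
  have htr := LinearMap.mem_ker.1 hXt
  rw [trace_smul_one] at htr
  rcases mul_eq_zero.1 htr with h0 | h0
  · rw [h0, zero_smul]
  · haveI : Subsingleton U := Module.finrank_zero_iff.1 (by exact_mod_cast h0)
    exact Subsingleton.elim _ _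

/-- **LEMMA (7.5), FIRST STATEMENT: `𝔤𝔩(U) = 𝔤_-(U) ⊕ 𝔤_0(U) ⊕ 𝔤_+(U)`** for a finite-dimensional `U` with a
non-degenerate `ε`-symmetric form (`ε² = 1`; characteristic `0`): the internal direct sum (Mathlib
`DirectSum.IsInternal`) of `𝔤_-(U) = 𝔞𝔲𝔱(U)` (the skew operators), `𝔤_0(U) = K · 1` (the scalars) and `𝔤_+(U)` (the
traceless self-adjoint operators). [cite: LooijengaLunts1997, Appendix Lemma (7.5), p. 28 L80–L89] -/
theorem isInternal_skew_scalar_symm (hB : B.Nondegenerate) {ε : K} (hflip : ∀ u u' : U, B u' u = ε * B u u')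
    (hε : ε * ε = 1) :
    DirectSum.IsInternal fun i : Fin 3 ↦
      ![B.skewAdjointSubmodule, K ∙ (1 : Module.End K U), B.selfAdjointSubmodule ⊓ LinearMap.ker (LinearMap.trace K U)] i := by
  rw [DirectSum.isInternal_submodule_iff_iSupIndep_and_iSup_eq_top]
  constructor
  · rw [iSupIndep_def]
    intro i
    fin_cases i
    · refine (disjoint_skew_scalar_sup_symm hB).mono_right (iSup₂_le fun j hj ↦ ?_)
      fin_cases j
      · exact absurd rfl hj
      · exact le_sup_left
      · exact le_sup_right
    · refine (disjoint_scalar_skew_sup_symm hB hflip hε).mono_right (iSup₂_le fun j hj ↦ ?_)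
      fin_cases j
      · exact le_sup_left
      · exact absurd rfl hj
      · exact le_sup_right
    · refine (disjoint_symm_skew_sup_scalar hB).mono_right (iSup₂_le fun j hj ↦ ?_)
      fin_cases j
      · exact le_sup_left
      · exact le_sup_right
      · exact absurd rfl hj
  · rw [eq_top_iff, ← skew_sup_scalar_sup_symm_eq_top hB hflip hε]
    refine sup_le (sup_le ?_ ?_) ?_
    · exact le_iSup_of_le 0 le_rfl
    · exact le_iSup_of_le 1 le_rfl
    · exact le_iSup_of_le 2 le_rfl

end Decomposition

/-! ### §3 "an `𝔞𝔲𝔱(U)`-invariant decomposition"; `[𝔤_+(U), 𝔤_+(U)] ⊂ 𝔤_-(U)` -/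

section Invariant

variable {K : Type*} [Field K] {U : Type*} [AddCommGroup U] [Module K U] {B : BilinForm K U}

/-- `[𝔤_-, 𝔤_+] ⊆ 𝔤_+` at the level of operators: the bracket of a skew and a self-adjoint operator is self-adjoint.
[cite: LooijengaLunts1997, Appendix Lemma (7.5), p. 28 L88–L89 ("an 𝔞𝔲𝔱(U)-invariant decomposition")] -/
theorem isSelfAdjoint_bracket_of_isSkewAdjoint_of_isSelfAdjoint {a x : Module.End K U} (ha : B.IsSkewAdjoint a)
    (hx : B.IsSelfAdjoint x) : B.IsSelfAdjoint (⁅a, x⁆ : Module.End K U) := by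
  intro u u'
  have ha' : ∀ v w, B (a v) w = -B v (a w) := fun v w ↦ by rw [ha v w, Pi.neg_apply, map_neg]
  simp only [Ring.lie_def, LinearMap.sub_apply, Module.End.mul_apply, map_sub, ha', hx (a u) u']
  rw [hx u (a u')]
  ring

/-- The bracket of two operators is traceless. [folklore] -/
private theorem trace_bracket (x y : Module.End K U) : LinearMap.trace K U (⁅x, y⁆ : Module.End K U) = 0 := by
  rw [Ring.lie_def, map_sub, LinearMap.trace_mul_comm, sub_self]

/-- **"an `𝔞𝔲𝔱(U)`-invariant decomposition", summand `𝔤_-(U)`**: `[𝔞𝔲𝔱(U), 𝔤_-(U)] ⊆ 𝔤_-(U)` (Mathlib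
`isSkewAdjoint_bracket`). [cite: LooijengaLunts1997, Appendix Lemma (7.5), p. 28 L88–L89] -/
theorem lie_mem_skewAdjointSubmodule {a x : Module.End K U} (ha : a ∈ B.skewAdjointSubmodule)
    (hx : x ∈ B.skewAdjointSubmodule) : (⁅a, x⁆ : Module.End K U) ∈ B.skewAdjointSubmodule :=
  B.isSkewAdjoint_bracket ha hx

/-- **"an `𝔞𝔲𝔱(U)`-invariant decomposition", summand `𝔤_0(U)`**: `[𝔞𝔲𝔱(U), 𝔤_0(U)] = 0 ⊆ 𝔤_0(U)`.
[cite: LooijengaLunts1997, Appendix Lemma (7.5), p. 28 L88–L89] -/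
theorem lie_mem_span_one (a : Module.End K U) {x : Module.End K U} (hx : x ∈ K ∙ (1 : Module.End K U)) :
    (⁅a, x⁆ : Module.End K U) ∈ K ∙ (1 : Module.End K U) := by
  obtain ⟨c, rfl⟩ := Submodule.mem_span_singleton.1 hx
  rw [Ring.lie_def, mul_smul_comm, smul_mul_assoc, mul_one, one_mul, sub_self]
  exact Submodule.zero_mem _

/-- **"an `𝔞𝔲𝔱(U)`-invariant decomposition", summand `𝔤_+(U)`**: `[𝔞𝔲𝔱(U), 𝔤_+(U)] ⊆ 𝔤_+(U)` (self-adjoint by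
`isSelfAdjoint_bracket_of_isSkewAdjoint_of_isSelfAdjoint`, traceless as a commutator).
[cite: LooijengaLunts1997, Appendix Lemma (7.5), p. 28 L88–L89] -/
theorem lie_mem_selfAdjointSubmodule_inf_ker_trace {a x : Module.End K U} (ha : a ∈ B.skewAdjointSubmodule)
    (hx : x ∈ B.selfAdjointSubmodule ⊓ LinearMap.ker (LinearMap.trace K U)) :
    (⁅a, x⁆ : Module.End K U) ∈ B.selfAdjointSubmodule ⊓ LinearMap.ker (LinearMap.trace K U) :=
  ⟨(LinearMap.mem_selfAdjointSubmodule _).2 (isSelfAdjoint_bracket_of_isSkewAdjoint_of_isSelfAdjoint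
      ((LinearMap.mem_skewAdjointSubmodule _).1 ha) ((LinearMap.mem_selfAdjointSubmodule _).1 hx.1)),
    LinearMap.mem_ker.2 (trace_bracket a x)⟩

/-- **`[𝔤_+(U), 𝔤_+(U)] ⊂ 𝔤_-(U)`** for the subspaces. [cite: LooijengaLunts1997, Appendix Lemma (7.5), p. 28 L90–L91, L95–L96] -/
theorem lie_mem_skewAdjointSubmodule_of_mem_selfAdjointSubmodule {x y : Module.End K U}
    (hx : x ∈ B.selfAdjointSubmodule ⊓ LinearMap.ker (LinearMap.trace K U))
    (hy : y ∈ B.selfAdjointSubmodule ⊓ LinearMap.ker (LinearMap.trace K U)) :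
    (⁅x, y⁆ : Module.End K U) ∈ B.skewAdjointSubmodule :=
  -- the operator statement `[sym, sym]` skew is A1-155's `isSkewAdjoint_bracket_of_isSelfAdjoint`
  (LinearMap.mem_skewAdjointSubmodule _).2 (isSkewAdjoint_bracket_of_isSelfAdjoint
    ((LinearMap.mem_selfAdjointSubmodule _).1 hx.1) ((LinearMap.mem_selfAdjointSubmodule _).1 hy.1))

end Invariant

/-! ### §4 (rider A1-161) "If `dim U > 2`, then `[𝔤_+(U), 𝔤_+(U)] = 𝔤_-(U)`", I: symmetric forms, by elementary operators

The printed proof ("`[𝔤_+(U), 𝔤_+(U)]` is a nontrivial subspace of `𝔤_-(U)` and hence equal to it (since `𝔤_-(U)` is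
irreducible)") is replaced by an elementary computation with the rank-`≤ 2` operators `t_{x,y} : w ↦ ⟨x, w⟩ y`
(Mathlib `(B x).smulRight y`): for a symmetric form `s_{x,y} = t_{x,y} + t_{y,x}` is self-adjoint with trace `2⟨x, y⟩`,
`r_{x,y} = t_{x,y} - t_{y,x}` is skew, `[s_{u,w}, s_{w,v}] = ⟨w, w⟩ r_{v,u}` for `w ⊥ u, v`, and in an orthogonal basis
`(e_i)` (Mathlib `LinearMap.BilinForm.exists_orthogonal_basis`) every skew `X` is `½ Σ_i ⟨e_i, e_i⟩⁻¹ r_{e_i, X e_i}`;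
`dim U ≥ 3` supplies, for `i ≠ j`, a third index `k` with `r_{e_i,e_j} = ⟨e_k, e_k⟩⁻¹ [s_{e_j,e_k}, s_{e_k,e_i}]`. -/

section EqualitySymm

variable {K : Type*} [Field K] {U : Type*} [AddCommGroup U] [Module K U] {B : BilinForm K U}

/-- The operators `t_{x,y} : w ↦ ⟨x, w⟩ y` compose by `t_{x,y} t_{x',y'} = ⟨x, y'⟩ t_{x',y}`. [folklore] -/
private theorem smulRight_mul_smulRight (x y x' y' : U) :
    (B x).smulRight y * (B x').smulRight y' = B x y' • (B x').smulRight y := by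
  ext w
  simp only [Module.End.mul_apply, LinearMap.smulRight_apply, map_smul, LinearMap.smul_apply, smul_smul]
  rw [mul_comm]

/-- `t_{x, y + y'} = t_{x,y} + t_{x,y'}` and `t_{y + y', x} = t_{y,x} + t_{y',x}`, packaged for `r_{x,y} = t_{x,y} - t_{y,x}`:
`r_{x,·}` is additive. [folklore] -/
private theorem smulRight_sub_smulRight_add (x y y' : U) :
    (B x).smulRight (y + y') - (B (y + y')).smulRight x =
      ((B x).smulRight y - (B y).smulRight x) + ((B x).smulRight y' - (B y').smulRight x) := by
  ext w
  simp only [LinearMap.sub_apply, LinearMap.add_apply, LinearMap.smulRight_apply, map_add, smul_add, add_smul]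
  abel

/-- `r_{x,·}` is homogeneous. [folklore] -/
private theorem smulRight_sub_smulRight_smul (x y : U) (c : K) :
    (B x).smulRight (c • y) - (B (c • y)).smulRight x = c • ((B x).smulRight y - (B y).smulRight x) := by
  ext w
  simp only [LinearMap.sub_apply, LinearMap.smulRight_apply, map_smul, LinearMap.smul_apply, smul_eq_mul, smul_sub,
    smul_smul, mul_comm c]

/-- For a SYMMETRIC form the operators `s_{x,y} = t_{x,y} + t_{y,x} : w ↦ ⟨x, w⟩ y + ⟨y, w⟩ x` satisfy
`⟨s u, u'⟩ = +⟨u, s u'⟩` (they lie in `𝔤_+(U) + 𝔤_0(U)`). [cite: LooijengaLunts1997, Appendix Lemma (7.5), p. 28 L82–L85] -/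
theorem isSelfAdjoint_smulRight_add_smulRight (hsymm : ∀ u u' : U, B u u' = B u' u) (x y : U) :
    B.IsSelfAdjoint ⇑((B x).smulRight y + (B y).smulRight x) := by
  intro w w'
  simp only [LinearMap.add_apply, LinearMap.smulRight_apply, map_add, map_smul, LinearMap.smul_apply, smul_eq_mul]
  rw [hsymm w y, hsymm w x]
  ring

/-- For a SYMMETRIC form the operators `r_{x,y} = t_{x,y} - t_{y,x} : w ↦ ⟨x, w⟩ y - ⟨y, w⟩ x` satisfy
`⟨r u, u'⟩ = -⟨u, r u'⟩` (they lie in `𝔞𝔲𝔱(U) = 𝔤_-(U)`). [cite: LooijengaLunts1997, Appendix Lemma (7.5), p. 28 L82–L85] -/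
theorem isSkewAdjoint_smulRight_sub_smulRight (hsymm : ∀ u u' : U, B u u' = B u' u) (x y : U) :
    B.IsSkewAdjoint ⇑((B x).smulRight y - (B y).smulRight x) := by
  intro w w'
  simp only [LinearMap.sub_apply, LinearMap.smulRight_apply, map_sub, map_smul, LinearMap.smul_apply, smul_eq_mul,
    Pi.neg_apply, map_neg]
  rw [hsymm w y, hsymm w x]
  ring

/-- **The key bracket `[s_{u,w}, s_{w,v}] = ⟨w, w⟩ r_{v,u}` (`w ⊥ u`, `w ⊥ v`, symmetric form)**: a bracket of two
self-adjoint elementary operators is `⟨w, w⟩` times the elementary skew operator `r_{v,u} = t_{v,u} - t_{u,v}` — the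
computation behind "`[𝔤_+(U), 𝔤_+(U)]` is a nontrivial subspace of `𝔤_-(U)`".
[cite: LooijengaLunts1997, Appendix Lemma (7.5) proof, p. 28 L95–L96] -/
theorem lie_smulRight_add_smulRight (hsymm : ∀ u u' : U, B u u' = B u' u) {u v w : U} (huw : B u w = 0)
    (hwv : B w v = 0) :
    (⁅(B u).smulRight w + (B w).smulRight u, (B w).smulRight v + (B v).smulRight w⁆ : Module.End K U) =
      B w w • ((B v).smulRight u - (B u).smulRight v) := by
  have hwu : B w u = 0 := by rw [hsymm, huw]
  have hvw : B v w = 0 := by rw [hsymm, hwv]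
  rw [Ring.lie_def]
  simp only [add_mul, mul_add, smulRight_mul_smulRight, huw, hwu, hwv, hvw, zero_smul, add_zero, zero_add,
    hsymm v u, smul_sub]
  abel

/-- In dimension `≥ 3` two indices leave room for a third. [folklore] -/
private theorem exists_ne_and_ne {N : ℕ} (h3 : 3 ≤ N) (i j : Fin N) : ∃ k : Fin N, k ≠ i ∧ k ≠ j := by
  by_contra h
  push Not at h
  have h0 := h ⟨0, by omega⟩
  have h1 := h ⟨1, by omega⟩
  have h2 := h ⟨2, by omega⟩
  simp only [ne_eq, Fin.ext_iff] at h0 h1 h2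
  omega

/-- Expansion in an orthogonal basis of non-isotropic vectors: `v = Σ_i ⟨e_i, e_i⟩⁻¹ ⟨e_i, v⟩ e_i`. [folklore] -/
private theorem sum_smul_eq_self_of_orthogonal {ι : Type*} [Fintype ι] (e : Basis ι K U)
    (he : ∀ i j, i ≠ j → B (e i) (e j) = 0) (hne : ∀ i, B (e i) (e i) ≠ 0) (v : U) :
    ∑ i, ((B (e i) (e i))⁻¹ * B (e i) v) • e i = v := by
  classical
  have hcoef : ∀ i, B (e i) v = e.repr v i * B (e i) (e i) := by
    intro i
    conv_lhs => rw [← e.sum_repr v]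
    rw [map_sum, Finset.sum_eq_single i]
    · rw [map_smul, smul_eq_mul]
    · intro j _ hji
      rw [map_smul, smul_eq_mul, he i j (Ne.symm hji), mul_zero]
    · intro hi
      exact absurd (Finset.mem_univ i) hi
  conv_rhs => rw [← e.sum_repr v]
  refine Finset.sum_congr rfl fun i _ ↦ ?_
  rw [hcoef i, ← mul_assoc, mul_comm ((B (e i) (e i))⁻¹), mul_assoc, inv_mul_cancel₀ (hne i), mul_one]

/-- **Every `X ∈ 𝔞𝔲𝔱(U)` is a combination of the elementary skew operators**: for a symmetric form, an orthogonal basis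
`(e_i)` of non-isotropic vectors and a skew `X`, `2X = Σ_i ⟨e_i, e_i⟩⁻¹ r_{e_i, X e_i}` with
`r_{x,y} = t_{x,y} - t_{y,x}` (the spanning half of our proof of (7.5) "`[𝔤_+(U), 𝔤_+(U)] = 𝔤_-(U)`"). [folklore] -/
private theorem two_smul_eq_sum_smulRight_sub_of_isSkewAdjoint {ι : Type*} [Fintype ι] (e : Basis ι K U)
    (he : ∀ i j, i ≠ j → B (e i) (e j) = 0) (hne : ∀ i, B (e i) (e i) ≠ 0) {X : Module.End K U}
    (hX : B.IsSkewAdjoint X) :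
    (2 : K) • X = ∑ i, (B (e i) (e i))⁻¹ • ((B (e i)).smulRight (X (e i)) - (B (X (e i))).smulRight (e i)) := by
  have hexp := sum_smul_eq_self_of_orthogonal e he hne
  have hX' : ∀ a b, B (X a) b = -B a (X b) := fun a b ↦ by rw [hX a b, Pi.neg_apply, map_neg]
  ext w
  simp only [LinearMap.smul_apply, LinearMap.coe_sum, Finset.sum_apply, LinearMap.sub_apply,
    LinearMap.smulRight_apply, hX', neg_smul, sub_neg_eq_add, smul_add, smul_smul]
  rw [Finset.sum_add_distrib, hexp (X w)]
  have h1 : ∑ i, ((B (e i) (e i))⁻¹ * B (e i) w) • X (e i) = X w := by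
    conv_rhs => rw [← hexp w, map_sum]
    exact Finset.sum_congr rfl fun i _ ↦ (map_smul X _ _).symm
  rw [h1, two_smul]

variable [FiniteDimensional K U]

/-- `tr s_{x,y} = 2⟨x, y⟩` (`tr t_{x,y} = ⟨x, y⟩`): so `s_{x,y} ∈ 𝔰𝔩(U)` iff `x ⊥ y` (characteristic `≠ 2`).
[cite: LooijengaLunts1997, Appendix Lemma (7.5), p. 28 L82–L85 ("x ∈ 𝔰𝔩(U)")] -/
theorem trace_smulRight_add_smulRight (hsymm : ∀ u u' : U, B u u' = B u' u) (x y : U) :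
    LinearMap.trace K U ((B x).smulRight y + (B y).smulRight x) = 2 * B x y := by
  rw [map_add, LinearMap.trace_smulRight, LinearMap.trace_smulRight, hsymm y x, two_mul]

/-- `s_{x,y} ∈ 𝔤_+(U) = {self-adjoint} ∩ 𝔰𝔩(U)` for `x ⊥ y` (symmetric form).
[cite: LooijengaLunts1997, Appendix Lemma (7.5), p. 28 L82–L85] -/
theorem smulRight_add_smulRight_mem (hsymm : ∀ u u' : U, B u u' = B u' u) {x y : U} (hxy : B x y = 0) :
    (B x).smulRight y + (B y).smulRight x ∈ B.selfAdjointSubmodule ⊓ LinearMap.ker (LinearMap.trace K U) :=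
  ⟨(LinearMap.mem_selfAdjointSubmodule _).2 (isSelfAdjoint_smulRight_add_smulRight hsymm x y),
    LinearMap.mem_ker.2 (by rw [trace_smulRight_add_smulRight hsymm, hxy, mul_zero])⟩

/-- **`𝔤_-(U) ⊆ [𝔤_+(U), 𝔤_+(U)]` for a non-degenerate SYMMETRIC form on a space of dimension `≥ 3`** (characteristic
`0`): every skew operator is a linear combination of brackets `[x, y]` of traceless self-adjoint operators.
[cite: LooijengaLunts1997, Appendix Lemma (7.5) ("If dim U > 2, then [𝔤_+(U), 𝔤_+(U)] = 𝔤_-(U)"), p. 28 L90–L91, L95–L96] -/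
theorem skewAdjointSubmodule_le_span_lie_of_symm [CharZero K] (hB : B.Nondegenerate)
    (hsymm : ∀ u u' : U, B u u' = B u' u) (h3 : 3 ≤ finrank K U) :
    B.skewAdjointSubmodule ≤ Submodule.span K
      {z | ∃ x ∈ B.selfAdjointSubmodule ⊓ LinearMap.ker (LinearMap.trace K U),
        ∃ y ∈ B.selfAdjointSubmodule ⊓ LinearMap.ker (LinearMap.trace K U), ⁅x, y⁆ = z} := by
  intro X hX
  rw [LinearMap.mem_skewAdjointSubmodule] at hX
  set P := B.selfAdjointSubmodule ⊓ LinearMap.ker (LinearMap.trace K U) with hP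
  set T := Submodule.span K {z | ∃ x ∈ P, ∃ y ∈ P, ⁅x, y⁆ = z} with hT
  haveI : Invertible (2 : K) := invertibleOfNonzero two_ne_zero
  obtain ⟨e, he⟩ := LinearMap.BilinForm.exists_orthogonal_basis (B := B) ⟨fun x y ↦ hsymm x y⟩
  have he' : ∀ i j, i ≠ j → B (e i) (e j) = 0 := fun i j hij ↦ he hij
  have hne : ∀ i, B (e i) (e i) ≠ 0 := fun i ↦ he.not_isOrtho_basis_self_of_separatingLeft hB.1 i
  -- (1) the elementary skew operators `r_{e_i,e_j}` lie in `T`: `r_{e_i,e_j} = λ_k⁻¹ [s_{e_j,e_k}, s_{e_k,e_i}]`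
  have hr : ∀ i j, (B (e i)).smulRight (e j) - (B (e j)).smulRight (e i) ∈ T := by
    intro i j
    by_cases hij : i = j
    · subst hij
      rw [sub_self]
      exact T.zero_mem
    obtain ⟨k, hki, hkj⟩ := exists_ne_and_ne h3 i j
    have hmem : (⁅(B (e j)).smulRight (e k) + (B (e k)).smulRight (e j),
        (B (e k)).smulRight (e i) + (B (e i)).smulRight (e k)⁆ : Module.End K U) ∈ T :=
      Submodule.subset_span ⟨_, smulRight_add_smulRight_mem hsymm (he' j k (Ne.symm hkj)), _,
        smulRight_add_smulRight_mem hsymm (he' k i hki), rfl⟩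
    rw [lie_smulRight_add_smulRight hsymm (he' j k (Ne.symm hkj)) (he' k i hki)] at hmem
    have h' := T.smul_mem (B (e k) (e k))⁻¹ hmem
    rwa [smul_smul, inv_mul_cancel₀ (hne k), one_smul] at h'
  -- (2) hence `r_{e_i, y} ∈ T` for every `y` (linearity in `y`)
  have hr' : ∀ i (y : U), (B (e i)).smulRight y - (B y).smulRight (e i) ∈ T := by
    intro i y
    refine Submodule.span_induction (p := fun y _ ↦ (B (e i)).smulRight y - (B y).smulRight (e i) ∈ T)
      ?_ ?_ ?_ ?_ (e.mem_span y)
    · rintro _ ⟨j, rfl⟩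
      exact hr i j
    · have h0 : (B (e i)).smulRight (0 : U) - (B (0 : U)).smulRight (e i) = 0 := by
        ext w
        simp only [LinearMap.sub_apply, LinearMap.smulRight_apply, smul_zero, map_zero, LinearMap.zero_apply,
          zero_smul, sub_self]
      rw [h0]
      exact T.zero_mem
    · intro x y _ _ hx hy
      rw [smulRight_sub_smulRight_add]
      exact T.add_mem hx hy
    · intro c x _ hx
      rw [smulRight_sub_smulRight_smul]
      exact T.smul_mem c hx
  -- (3) `2X = Σ_i λ_i⁻¹ r_{e_i, X e_i} ∈ T`
  have h2X : (2 : K) • X ∈ T := by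
    rw [two_smul_eq_sum_smulRight_sub_of_isSkewAdjoint e he' hne hX]
    exact T.sum_mem fun i _ ↦ T.smul_mem _ (hr' i (X (e i)))
  have h' := T.smul_mem (2 : K)⁻¹ h2X
  rwa [smul_smul, inv_mul_cancel₀ (two_ne_zero : (2 : K) ≠ 0), one_smul] at h'

/-- **(7.5) "If `dim U > 2`, then `[𝔤_+(U), 𝔤_+(U)] = 𝔤_-(U)`" for a non-degenerate SYMMETRIC form** (`ε = 1`;
characteristic `0`, `dim U ≥ 3`): the span of the brackets of traceless self-adjoint operators is exactly the space of
skew operators `𝔞𝔲𝔱(U) = 𝔤_-(U)`. [cite: LooijengaLunts1997, Appendix Lemma (7.5), p. 28 L90–L91, L95–L96] -/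
theorem span_lie_selfAdjoint_eq_skewAdjointSubmodule_of_symm [CharZero K] (hB : B.Nondegenerate)
    (hsymm : ∀ u u' : U, B u u' = B u' u) (h3 : 3 ≤ finrank K U) :
    Submodule.span K
        {z | ∃ x ∈ B.selfAdjointSubmodule ⊓ LinearMap.ker (LinearMap.trace K U),
          ∃ y ∈ B.selfAdjointSubmodule ⊓ LinearMap.ker (LinearMap.trace K U), ⁅x, y⁆ = z} =
      B.skewAdjointSubmodule := by
  refine le_antisymm (Submodule.span_le.2 ?_) (skewAdjointSubmodule_le_span_lie_of_symm hB hsymm h3)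
  rintro _ ⟨x, hx, y, hy, rfl⟩
  exact lie_mem_skewAdjointSubmodule_of_mem_selfAdjointSubmodule hx hy

end EqualitySymm

/-! ### §5 (rider A1-161) "`[𝔤_+(U), 𝔤_+(U)] = 𝔤_-(U)`", II: antisymmetric (symplectic) forms

For `⟨u, u'⟩ = -⟨u', u⟩` the roles of `t_{x,y} ± t_{y,x}` swap: `a_{x,y} = t_{x,y} - t_{y,x}` is self-adjoint with
trace `2⟨x, y⟩` and `t_{w,w}` is skew (`∈ 𝔰𝔭(U) = 𝔞𝔲𝔱(U)`); `[a_{u,w}, a_{w,v}] = 2⟨u, v⟩ t_{w,w}` for `w ⊥ u, v`;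
`dim U ≥ 3` gives, for every `w`, a pair `u, v ⊥ w` with `⟨u, v⟩ ≠ 0` (a totally isotropic subspace has at most half
the dimension); and every skew `X` is `½ Σ_i (t_{f_i, X e_i} + t_{X e_i, f_i})` for a dual pair of families
`Σ_i t_{f_i, e_i} = 1`, while `t_{x,y} + t_{y,x} = t_{x+y,x+y} - t_{x,x} - t_{y,y}`. -/

section EqualityAlt

variable {K : Type*} [Field K] {U : Type*} [AddCommGroup U] [Module K U] {B : BilinForm K U}

/-- For an ANTISYMMETRIC form the operators `a_{x,y} = t_{x,y} - t_{y,x}` satisfy `⟨a u, u'⟩ = +⟨u, a u'⟩`.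
[cite: LooijengaLunts1997, Appendix Lemma (7.5), p. 28 L82–L85] -/
theorem isSelfAdjoint_smulRight_sub_smulRight (halt : ∀ u u' : U, B u u' = -B u' u) (x y : U) :
    B.IsSelfAdjoint ⇑((B x).smulRight y - (B y).smulRight x) := by
  intro w w'
  simp only [LinearMap.sub_apply, LinearMap.smulRight_apply, map_sub, map_smul, LinearMap.smul_apply, smul_eq_mul]
  rw [halt w y, halt w x]
  ring

/-- For an ANTISYMMETRIC form the operators `t_{w,w} : u ↦ ⟨w, u⟩ w` satisfy `⟨t u, u'⟩ = -⟨u, t u'⟩`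
(`t_{w,w} ∈ 𝔞𝔲𝔱(U) = 𝔰𝔭(U)`). [cite: LooijengaLunts1997, Appendix Lemma (7.5), p. 28 L82–L85] -/
theorem isSkewAdjoint_smulRight_self (halt : ∀ u u' : U, B u u' = -B u' u) (w : U) :
    B.IsSkewAdjoint ⇑((B w).smulRight w) := by
  intro u u'
  simp only [LinearMap.smulRight_apply, map_smul, LinearMap.smul_apply, smul_eq_mul, Pi.neg_apply, map_neg]
  rw [halt u w]
  ring

/-- **The key bracket `[a_{u,w}, a_{w,v}] = 2⟨u, v⟩ t_{w,w}` (`w ⊥ u`, `w ⊥ v`, `⟨w, w⟩ = 0`, antisymmetric form)**.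
[cite: LooijengaLunts1997, Appendix Lemma (7.5) proof, p. 28 L95–L96] -/
theorem lie_smulRight_sub_smulRight (halt : ∀ u u' : U, B u u' = -B u' u) {u v w : U} (huw : B u w = 0)
    (hwv : B w v = 0) (hww : B w w = 0) :
    (⁅(B u).smulRight w - (B w).smulRight u, (B w).smulRight v - (B v).smulRight w⁆ : Module.End K U) =
      (2 * B u v) • (B w).smulRight w := by
  have hwu : B w u = 0 := by rw [halt, huw, neg_zero]
  have hvw : B v w = 0 := by rw [halt, hwv, neg_zero]
  rw [Ring.lie_def]
  simp only [sub_mul, mul_sub, smulRight_mul_smulRight, huw, hwu, hwv, hvw, hww, zero_smul, sub_zero, zero_sub,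
    zero_add, halt v u, neg_smul, sub_neg_eq_add, two_mul, add_smul]

/-- Polarisation: `t_{x,y} + t_{y,x} = t_{x+y,x+y} - t_{x,x} - t_{y,y}`. [folklore] -/
private theorem smulRight_add_smulRight_eq_polar (x y : U) :
    (B x).smulRight y + (B y).smulRight x =
      (B (x + y)).smulRight (x + y) - (B x).smulRight x - (B y).smulRight y := by
  ext w
  simp only [LinearMap.add_apply, LinearMap.sub_apply, LinearMap.smulRight_apply, map_add, smul_add, add_smul]
  abel

/-- If `Σ_i ⟨f_i, w⟩ e_i = w` for all `w` ("`Σ_i t_{f_i,e_i} = 1`"), then also `Σ_i ⟨v, e_i⟩ f_i = v` for all `v`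
(non-degenerate form). [folklore] -/
private theorem sum_smul_eq_self_of_sum_smul_eq_self (hB : B.Nondegenerate) {ι : Type*} [Fintype ι] {e f : ι → U}
    (hfe : ∀ w : U, ∑ i, B (f i) w • e i = w) (v : U) : ∑ i, B v (e i) • f i = v := by
  have h0 : ∑ i, B v (e i) • f i - v = 0 := by
    refine hB.1 _ fun y ↦ ?_
    rw [LinearMap.BilinForm.sub_left, LinearMap.BilinForm.sum_left, sub_eq_zero]
    conv_rhs => rw [← hfe y, LinearMap.BilinForm.sum_right]
    refine Finset.sum_congr rfl fun i _ ↦ ?_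
    rw [LinearMap.BilinForm.smul_left, LinearMap.BilinForm.smul_right, mul_comm]
  exact sub_eq_zero.1 h0

/-- **Every `X ∈ 𝔰𝔭(U)` is a combination of the operators `t_{x,y} + t_{y,x}`**: for an antisymmetric
non-degenerate form, families with `Σ_i t_{f_i,e_i} = 1` and a skew `X`, `2X = Σ_i (t_{f_i, X e_i} + t_{X e_i, f_i})`.
(the spanning half of our proof of (7.5) "`[𝔤_+(U), 𝔤_+(U)] = 𝔤_-(U)`"). [folklore] -/
private theorem two_smul_eq_sum_smulRight_add_of_isSkewAdjoint (hB : B.Nondegenerate)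
    (halt : ∀ u u' : U, B u u' = -B u' u) {ι : Type*} [Fintype ι] {e f : ι → U}
    (hfe : ∀ w : U, ∑ i, B (f i) w • e i = w) {X : Module.End K U} (hX : B.IsSkewAdjoint X) :
    (2 : K) • X = ∑ i, ((B (f i)).smulRight (X (e i)) + (B (X (e i))).smulRight (f i)) := by
  have hflip := sum_smul_eq_self_of_sum_smul_eq_self hB hfe
  have hX' : ∀ a b, B (X a) b = B (X b) a := fun a b ↦ by rw [hX a b, Pi.neg_apply, map_neg, halt a, neg_neg]
  ext w
  have hXw : ∀ a, B (X a) w = B (X w) a := fun a ↦ hX' a w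
  simp only [LinearMap.smul_apply, LinearMap.coe_sum, Finset.sum_apply, LinearMap.add_apply,
    LinearMap.smulRight_apply, hXw]
  rw [Finset.sum_add_distrib, hflip (X w)]
  have h1 : ∑ i, B (f i) w • X (e i) = X w := by
    conv_rhs => rw [← hfe w, map_sum]
    exact Finset.sum_congr rfl fun i _ ↦ (map_smul X _ _).symm
  rw [h1, two_smul]

variable [FiniteDimensional K U]

/-- A dual pair of families `Σ_i t_{f_i,e_i} = 1` exists for a non-degenerate form on a finite-dimensional space
(`e` a basis, `f_i` the vector representing the `i`-th coordinate through `U ≅ U^*`). [folklore] -/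
private theorem exists_sum_smul_eq_self (hB : B.Nondegenerate) :
    ∃ e f : Fin (finrank K U) → U, ∀ w : U, ∑ i, B (f i) w • e i = w := by
  let e := Module.finBasis K U
  refine ⟨e, fun i ↦ (B.toDual hB).symm (e.coord i), fun w ↦ ?_⟩
  conv_rhs => rw [← e.sum_repr w]
  refine Finset.sum_congr rfl fun i _ ↦ ?_
  rw [← LinearMap.BilinForm.toDual_def hB, LinearEquiv.apply_symm_apply, Basis.coord_apply]

/-- `tr a_{x,y} = 2⟨x, y⟩` for an antisymmetric form: so `a_{x,y} ∈ 𝔰𝔩(U)` iff `x ⊥ y` (characteristic `≠ 2`).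
[cite: LooijengaLunts1997, Appendix Lemma (7.5), p. 28 L82–L85] -/
theorem trace_smulRight_sub_smulRight (halt : ∀ u u' : U, B u u' = -B u' u) (x y : U) :
    LinearMap.trace K U ((B x).smulRight y - (B y).smulRight x) = 2 * B x y := by
  rw [map_sub, LinearMap.trace_smulRight, LinearMap.trace_smulRight, halt y x, sub_neg_eq_add, two_mul]

/-- `a_{x,y} ∈ 𝔤_+(U)` for `x ⊥ y` (antisymmetric form). [cite: LooijengaLunts1997, Appendix Lemma (7.5), p. 28 L82–L85] -/
theorem smulRight_sub_smulRight_mem (halt : ∀ u u' : U, B u u' = -B u' u) {x y : U} (hxy : B x y = 0) :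
    (B x).smulRight y - (B y).smulRight x ∈ B.selfAdjointSubmodule ⊓ LinearMap.ker (LinearMap.trace K U) :=
  ⟨(LinearMap.mem_selfAdjointSubmodule _).2 (isSelfAdjoint_smulRight_sub_smulRight halt x y),
    LinearMap.mem_ker.2 (by rw [trace_smulRight_sub_smulRight halt, hxy, mul_zero])⟩

/-- For a non-degenerate antisymmetric form on a space of dimension `≥ 3` and any `w`, there are `u, v ⊥ w` with
`⟨u, v⟩ ≠ 0`: otherwise the hyperplane (or all of `U`) `w^⊥` would be totally isotropic, of dimension `≥ dim U - 1`
and `≤ ½ dim U`. [folklore] -/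
private theorem exists_orthogonal_pair_of_alt (hB : B.Nondegenerate) (halt : ∀ u u' : U, B u u' = -B u' u)
    (h3 : 3 ≤ finrank K U) (w : U) : ∃ u v : U, B u w = 0 ∧ B w v = 0 ∧ B u v ≠ 0 := by
  by_contra h
  push Not at h
  have hWW : ∀ u ∈ LinearMap.ker (B w), ∀ v ∈ LinearMap.ker (B w), B u v = 0 := fun u hu v hv ↦
    h u v (by rw [halt, LinearMap.mem_ker.1 hu, neg_zero]) (LinearMap.mem_ker.1 hv)
  have hdim : finrank K U ≤ finrank K (LinearMap.ker (B w)) + 1 := by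
    have h1 := LinearMap.finrank_range_add_finrank_ker (B w)
    have h2 : finrank K (LinearMap.range (B w)) ≤ 1 :=
      (Submodule.finrank_le _).trans_eq (Module.finrank_self K)
    omega
  have hle : LinearMap.ker (B w) ≤ B.orthogonal (LinearMap.ker (B w)) := fun v hv ↦
    LinearMap.BilinForm.mem_orthogonal_iff.2 fun u hu ↦ hWW u hu v hv
  have hrefl : B.IsRefl := fun x y hxy ↦ by rw [halt, hxy, neg_zero]
  have hsum := LinearMap.BilinForm.finrank_add_finrank_orthogonal hrefl (LinearMap.ker (B w))
  rw [LinearMap.BilinForm.orthogonal_top_eq_bot hB, inf_bot_eq, finrank_bot, add_zero] at hsum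
  have hmono := Submodule.finrank_mono hle
  omega

variable [CharZero K]

/-- `t_{w,w} ∈ [𝔤_+(U), 𝔤_+(U)]` (antisymmetric non-degenerate form, `dim U ≥ 3`): `t_{w,w} = (2⟨u, v⟩)⁻¹ [a_{u,w}, a_{w,v}]`.
[cite: LooijengaLunts1997, Appendix Lemma (7.5) proof, p. 28 L95–L96] -/
theorem smulRight_self_mem_span_lie_of_alt (hB : B.Nondegenerate) (halt : ∀ u u' : U, B u u' = -B u' u)
    (h3 : 3 ≤ finrank K U) (w : U) :
    (B w).smulRight w ∈ Submodule.span K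
      {z | ∃ x ∈ B.selfAdjointSubmodule ⊓ LinearMap.ker (LinearMap.trace K U),
        ∃ y ∈ B.selfAdjointSubmodule ⊓ LinearMap.ker (LinearMap.trace K U), ⁅x, y⁆ = z} := by
  obtain ⟨u, v, huw, hwv, huv⟩ := exists_orthogonal_pair_of_alt hB halt h3 w
  have hww : B w w = 0 := by
    have h := halt w w
    rwa [eq_neg_iff_add_eq_zero, add_self_eq_zero] at h
  have hmem : (⁅(B u).smulRight w - (B w).smulRight u, (B w).smulRight v - (B v).smulRight w⁆ : Module.End K U) ∈
      Submodule.span K {z | ∃ x ∈ B.selfAdjointSubmodule ⊓ LinearMap.ker (LinearMap.trace K U),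
        ∃ y ∈ B.selfAdjointSubmodule ⊓ LinearMap.ker (LinearMap.trace K U), ⁅x, y⁆ = z} :=
    Submodule.subset_span ⟨_, smulRight_sub_smulRight_mem halt huw, _, smulRight_sub_smulRight_mem halt hwv, rfl⟩
  rw [lie_smulRight_sub_smulRight halt huw hwv hww] at hmem
  have h' := Submodule.smul_mem _ (2 * B u v)⁻¹ hmem
  rwa [smul_smul, inv_mul_cancel₀ (mul_ne_zero two_ne_zero huv), one_smul] at h'

/-- **`𝔤_-(U) ⊆ [𝔤_+(U), 𝔤_+(U)]` for a non-degenerate ANTISYMMETRIC form on a space of dimension `≥ 3`**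
(characteristic `0`). [cite: LooijengaLunts1997, Appendix Lemma (7.5) ("If dim U > 2, then [𝔤_+(U), 𝔤_+(U)] = 𝔤_-(U)"), p. 28 L90–L91, L95–L96] -/
theorem skewAdjointSubmodule_le_span_lie_of_alt (hB : B.Nondegenerate) (halt : ∀ u u' : U, B u u' = -B u' u)
    (h3 : 3 ≤ finrank K U) :
    B.skewAdjointSubmodule ≤ Submodule.span K
      {z | ∃ x ∈ B.selfAdjointSubmodule ⊓ LinearMap.ker (LinearMap.trace K U),
        ∃ y ∈ B.selfAdjointSubmodule ⊓ LinearMap.ker (LinearMap.trace K U), ⁅x, y⁆ = z} := by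
  intro X hX
  rw [LinearMap.mem_skewAdjointSubmodule] at hX
  set T := Submodule.span K
      {z | ∃ x ∈ B.selfAdjointSubmodule ⊓ LinearMap.ker (LinearMap.trace K U),
        ∃ y ∈ B.selfAdjointSubmodule ⊓ LinearMap.ker (LinearMap.trace K U), ⁅x, y⁆ = z} with hT
  have ht : ∀ w : U, (B w).smulRight w ∈ T := smulRight_self_mem_span_lie_of_alt hB halt h3
  have hc : ∀ x y : U, (B x).smulRight y + (B y).smulRight x ∈ T := fun x y ↦ by
    rw [smulRight_add_smulRight_eq_polar]
    exact T.sub_mem (T.sub_mem (ht _) (ht _)) (ht _)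
  obtain ⟨e, f, hfe⟩ := exists_sum_smul_eq_self hB
  have h2X : (2 : K) • X ∈ T := by
    rw [two_smul_eq_sum_smulRight_add_of_isSkewAdjoint hB halt hfe hX]
    exact T.sum_mem fun i _ ↦ hc _ _
  have h' := T.smul_mem (2 : K)⁻¹ h2X
  rwa [smul_smul, inv_mul_cancel₀ (two_ne_zero : (2 : K) ≠ 0), one_smul] at h'

/-- **(7.5) "If `dim U > 2`, then `[𝔤_+(U), 𝔤_+(U)] = 𝔤_-(U)`" for a non-degenerate ANTISYMMETRIC form**
(`ε = -1`; characteristic `0`, `dim U ≥ 3`). [cite: LooijengaLunts1997, Appendix Lemma (7.5), p. 28 L90–L91, L95–L96] -/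
theorem span_lie_selfAdjoint_eq_skewAdjointSubmodule_of_alt (hB : B.Nondegenerate)
    (halt : ∀ u u' : U, B u u' = -B u' u) (h3 : 3 ≤ finrank K U) :
    Submodule.span K
        {z | ∃ x ∈ B.selfAdjointSubmodule ⊓ LinearMap.ker (LinearMap.trace K U),
          ∃ y ∈ B.selfAdjointSubmodule ⊓ LinearMap.ker (LinearMap.trace K U), ⁅x, y⁆ = z} =
      B.skewAdjointSubmodule := by
  refine le_antisymm (Submodule.span_le.2 ?_) (skewAdjointSubmodule_le_span_lie_of_alt hB halt h3)
  rintro _ ⟨x, hx, y, hy, rfl⟩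
  exact lie_mem_skewAdjointSubmodule_of_mem_selfAdjointSubmodule hx hy

end EqualityAlt

/-! ### §6 (rider A1-161) "If `dim U > 2`, then `[𝔤_+(U), 𝔤_+(U)] = 𝔤_-(U)`" for a non-degenerate `ε`-symmetric form -/

section Equality

variable {K : Type*} [Field K] {U : Type*} [AddCommGroup U] [Module K U] [FiniteDimensional K U] [CharZero K]
  {B : BilinForm K U}

/-- **(7.5) Lemma, "If `dim U > 2`, then `[𝔤_+(U), 𝔤_+(U)] = 𝔤_-(U)`"**: for a finite-dimensional `U` of dimension
`≥ 3` over a field of characteristic `0` with a non-degenerate `ε`-symmetric form (`⟨u', u⟩ = ε⟨u, u'⟩`, `ε² = 1`),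
the linear span of the brackets `[x, y] = xy - yx` of elements of `𝔤_+(U)` (the traceless operators with
`⟨xu, u'⟩ = +⟨u, xu'⟩`) is `𝔤_-(U) = 𝔞𝔲𝔱(U)` (the operators with `⟨xu, u'⟩ = -⟨u, xu'⟩`).  Proved by elementary
operators (§4 `ε = 1`, §5 `ε = -1`) instead of the printed irreducibility argument.
[cite: LooijengaLunts1997, Appendix Lemma (7.5), p. 28 L90–L91 (statement), L95–L96 (proof)] -/
theorem span_lie_selfAdjoint_eq_skewAdjointSubmodule (hB : B.Nondegenerate) {ε : K}
    (hflip : ∀ u u' : U, B u' u = ε * B u u') (hε : ε * ε = 1) (h3 : 3 ≤ finrank K U) :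
    Submodule.span K
        {z | ∃ x ∈ B.selfAdjointSubmodule ⊓ LinearMap.ker (LinearMap.trace K U),
          ∃ y ∈ B.selfAdjointSubmodule ⊓ LinearMap.ker (LinearMap.trace K U), ⁅x, y⁆ = z} =
      B.skewAdjointSubmodule := by
  rcases mul_self_eq_one_iff.1 hε with rfl | rfl
  · exact span_lie_selfAdjoint_eq_skewAdjointSubmodule_of_symm hB (fun u u' ↦ by rw [hflip u' u, one_mul]) h3
  · exact span_lie_selfAdjoint_eq_skewAdjointSubmodule_of_alt hB (fun u u' ↦ by rw [hflip u' u, neg_one_mul]) h3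

/-- The same equality with `𝔤_-(U)` written as `𝔞𝔲𝔱(U) ∩ 𝔰𝔩(U)` (as printed: "`𝔤_-(U)` … the set of `x ∈ 𝔰𝔩(U)`
satisfying `⟨xu, u'⟩ = -⟨u, xu'⟩`"; `𝔞𝔲𝔱(U) ⊆ 𝔰𝔩(U)` by §1). [cite: LooijengaLunts1997, Appendix Lemma (7.5), p. 28 L82–L91] -/
theorem span_lie_selfAdjoint_eq_skewAdjointSubmodule_inf_ker_trace (hB : B.Nondegenerate) {ε : K}
    (hflip : ∀ u u' : U, B u' u = ε * B u u') (hε : ε * ε = 1) (h3 : 3 ≤ finrank K U) :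
    Submodule.span K
        {z | ∃ x ∈ B.selfAdjointSubmodule ⊓ LinearMap.ker (LinearMap.trace K U),
          ∃ y ∈ B.selfAdjointSubmodule ⊓ LinearMap.ker (LinearMap.trace K U), ⁅x, y⁆ = z} =
      B.skewAdjointSubmodule ⊓ LinearMap.ker (LinearMap.trace K U) := by
  rw [skewAdjointSubmodule_inf_ker_trace hB hflip hε, span_lie_selfAdjoint_eq_skewAdjointSubmodule hB hflip hε h3]

end Equality

/-! ### §7 (rider A1-162) "there exists `Y ∈ 𝔤_ε(U)` such that `Y² ∈ 𝔤_+(U) + 𝔤_0(U)` is not a scalar and has nonzero trace"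

The last clause of (7.5) ("an easy exercise"), with explicit operators: for a symmetric form and orthogonal
non-isotropic `e₀ ⊥ e₁` (and a third basis vector), `Y = r_{e₀,e₁} ∈ 𝔤_-(U)` and `Y = s_{e₀,e₁} ∈ 𝔤_+(U)` have
`Y² = ∓(⟨e₀,e₀⟩ t_{e₁,e₁} + ⟨e₁,e₁⟩ t_{e₀,e₀})`; for an antisymmetric form and a hyperbolic pair `⟨e, f⟩ = 1`,
`Y = t_{e,f} + t_{f,e} ∈ 𝔰𝔭(U) = 𝔤_-(U)` has `Y² = t_{e,f} - t_{f,e}` (the projection onto `Ke ⊕ Kf`), and for two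
orthogonal hyperbolic pairs (`dim U ≥ 5`) `Y = P₁ - P₂ ∈ 𝔤_+(U)` has `Y² = P₁ + P₂`.  CAVEAT (SCOPE (b)): for `U`
symplectic of dimension `4` and `ε = +` the printed clause FAILS — every traceless self-adjoint `Y` then has a SCALAR
square (`𝔤_+(U) ≅ Λ²₀U` is the `5`-dimensional representation of `𝔰𝔭(4) ≅ 𝔰𝔬(5)` and `Y² = q(Y)·1`); that case is
PROVED in §8 (rider A1-163). -/

section SquareNotScalar

variable {K : Type*} [Field K] {U : Type*} [AddCommGroup U] [Module K U] {B : BilinForm K U}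

/-- "`Y² ∈ 𝔤_+(U) + 𝔤_0(U)`" for `Y ∈ 𝔤_+(U)`: the square of a self-adjoint operator is self-adjoint.
[cite: LooijengaLunts1997, Appendix Lemma (7.5), p. 28 L91–L93] -/
theorem isSelfAdjoint_mul_self_of_isSelfAdjoint {Y : Module.End K U} (hY : B.IsSelfAdjoint Y) :
    B.IsSelfAdjoint ⇑(Y * Y) := fun u v ↦ by
  rw [Module.End.mul_apply, Module.End.mul_apply, hY, hY]

/-- "`Y² ∈ 𝔤_+(U) + 𝔤_0(U)`" for `Y ∈ 𝔤_-(U)`: the square of a skew operator is self-adjoint.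
[cite: LooijengaLunts1997, Appendix Lemma (7.5), p. 28 L91–L93] -/
theorem isSelfAdjoint_mul_self_of_isSkewAdjoint {Y : Module.End K U} (hY : B.IsSkewAdjoint Y) :
    B.IsSelfAdjoint ⇑(Y * Y) := fun u v ↦ by
  have hY' : ∀ a b, B (Y a) b = -B a (Y b) := fun a b ↦ by rw [hY a b, Pi.neg_apply, map_neg]
  rw [Module.End.mul_apply, Module.End.mul_apply, hY', hY', neg_neg]

/-- For an ANTISYMMETRIC form the operators `t_{x,y} + t_{y,x}` are skew (`∈ 𝔰𝔭(U) = 𝔤_-(U)`).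
[cite: LooijengaLunts1997, Appendix Lemma (7.5), p. 28 L82–L85] -/
theorem isSkewAdjoint_smulRight_add_smulRight_of_alt (halt : ∀ u u' : U, B u u' = -B u' u) (x y : U) :
    B.IsSkewAdjoint ⇑((B x).smulRight y + (B y).smulRight x) := by
  intro w w'
  simp only [LinearMap.add_apply, LinearMap.smulRight_apply, map_add, map_smul, LinearMap.smul_apply, smul_eq_mul,
    Pi.neg_apply, map_neg]
  rw [halt w y, halt w x]
  ring

/-- An operator killing a non-zero vector but not another one is not a scalar. [folklore] -/
private theorem not_mem_span_one_of_apply {T : Module.End K U} {z w : U} (hz : z ≠ 0) (hTz : T z = 0)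
    (hTw : T w ≠ 0) : T ∉ K ∙ (1 : Module.End K U) := by
  intro hT
  obtain ⟨c, rfl⟩ := Submodule.mem_span_singleton.1 hT
  rw [LinearMap.smul_apply, Module.End.one_apply, smul_eq_zero] at hTz
  rcases hTz with rfl | h
  · exact hTw (by rw [zero_smul, LinearMap.zero_apply])
  · exact hz h

/-- `s_{x,y}² = ⟨x,x⟩ t_{y,y} + ⟨y,y⟩ t_{x,x}` for `x ⊥ y ⊥ x`. [folklore] -/
private theorem smulRight_add_smulRight_mul_self {x y : U} (hxy : B x y = 0) (hyx : B y x = 0) :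
    ((B x).smulRight y + (B y).smulRight x) * ((B x).smulRight y + (B y).smulRight x) =
      B x x • (B y).smulRight y + B y y • (B x).smulRight x := by
  simp only [add_mul, mul_add, smulRight_mul_smulRight, hxy, hyx, zero_smul, zero_add, add_zero]
  abel

/-- `r_{x,y}² = -(⟨x,x⟩ t_{y,y} + ⟨y,y⟩ t_{x,x})` for `x ⊥ y ⊥ x`. [folklore] -/
private theorem smulRight_sub_smulRight_mul_self {x y : U} (hxy : B x y = 0) (hyx : B y x = 0) :
    ((B x).smulRight y - (B y).smulRight x) * ((B x).smulRight y - (B y).smulRight x) =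
      -(B x x • (B y).smulRight y + B y y • (B x).smulRight x) := by
  simp only [sub_mul, mul_sub, smulRight_mul_smulRight, hxy, hyx, zero_smul, zero_sub, sub_zero]
  abel

/-- `(⟨x,x⟩ t_{y,y} + ⟨y,y⟩ t_{x,x}) z = 0` for `z ⊥ x, y`. [folklore] -/
private theorem sq_aux_apply_eq_zero {x y z : U} (hxz : B x z = 0) (hyz : B y z = 0) :
    (B x x • (B y).smulRight y + B y y • (B x).smulRight x) z = 0 := by
  rw [LinearMap.add_apply, LinearMap.smul_apply, LinearMap.smul_apply, LinearMap.smulRight_apply,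
    LinearMap.smulRight_apply, hxz, hyz, zero_smul, zero_smul, smul_zero, smul_zero, add_zero]

/-- `(⟨x,x⟩ t_{y,y} + ⟨y,y⟩ t_{x,x}) x = ⟨y,y⟩⟨x,x⟩ x` for `y ⊥ x`. [folklore] -/
private theorem sq_aux_apply_self {x y : U} (hyx : B y x = 0) :
    (B x x • (B y).smulRight y + B y y • (B x).smulRight x) x = (B y y * B x x) • x := by
  rw [LinearMap.add_apply, LinearMap.smul_apply, LinearMap.smul_apply, LinearMap.smulRight_apply,
    LinearMap.smulRight_apply, hyx, zero_smul, smul_zero, zero_add, smul_smul]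

/-- A hyperbolic pair inside a subspace on which the form does not vanish identically. [folklore] -/
private theorem exists_apply_eq_one_of_not_forall {W : Submodule K U} (h : ¬ ∀ u ∈ W, ∀ v ∈ W, B u v = 0) :
    ∃ e ∈ W, ∃ f ∈ W, B e f = 1 := by
  push Not at h
  obtain ⟨u, hu, v, hv, huv⟩ := h
  exact ⟨u, hu, (B u v)⁻¹ • v, W.smul_mem _ hv, by rw [map_smul, smul_eq_mul, inv_mul_cancel₀ huv]⟩

/-- `(t_{e,f} + t_{f,e})² = t_{e,f} - t_{f,e}` for a hyperbolic pair of isotropic vectors (`⟨e,f⟩ = 1 = -⟨f,e⟩`). [folklore] -/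
private theorem smulRight_add_smulRight_mul_self_of_pair {e f : U} (hef : B e f = 1) (hfe : B f e = -1)
    (hee : B e e = 0) (hff : B f f = 0) :
    ((B e).smulRight f + (B f).smulRight e) * ((B e).smulRight f + (B f).smulRight e) =
      (B e).smulRight f - (B f).smulRight e := by
  simp only [add_mul, mul_add, smulRight_mul_smulRight, hef, hfe, hee, hff, one_smul, zero_smul, neg_smul, add_zero,
    zero_add]
  abel

/-- `P = t_{e,f} - t_{f,e}` is idempotent for a hyperbolic pair of isotropic vectors. [folklore] -/
private theorem smulRight_sub_smulRight_mul_self_of_pair {e f : U} (hef : B e f = 1) (hfe : B f e = -1)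
    (hee : B e e = 0) (hff : B f f = 0) :
    ((B e).smulRight f - (B f).smulRight e) * ((B e).smulRight f - (B f).smulRight e) =
      (B e).smulRight f - (B f).smulRight e := by
  simp only [sub_mul, mul_sub, smulRight_mul_smulRight, hef, hfe, hee, hff, one_smul, zero_smul, neg_smul, sub_zero,
    zero_sub, neg_neg]

/-- `P₁ P₂ = 0` for hyperbolic pairs with `e₁, f₁ ⊥ e₂, f₂`. [folklore] -/
private theorem smulRight_sub_smulRight_mul_eq_zero {e₁ f₁ e₂ f₂ : U} (h₁ : B e₁ f₂ = 0) (h₂ : B e₁ e₂ = 0)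
    (h₃ : B f₁ f₂ = 0) (h₄ : B f₁ e₂ = 0) :
    ((B e₁).smulRight f₁ - (B f₁).smulRight e₁) * ((B e₂).smulRight f₂ - (B f₂).smulRight e₂) = 0 := by
  simp only [sub_mul, mul_sub, smulRight_mul_smulRight, h₁, h₂, h₃, h₄, zero_smul, sub_zero]

/-- `(t_{e,f} - t_{f,e}) z = ⟨e,z⟩ f - ⟨f,z⟩ e`, vanishing for `z ⊥ e, f`. [folklore] -/
private theorem smulRight_sub_smulRight_apply_eq_zero {e f z : U} (hez : B e z = 0) (hfz : B f z = 0) :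
    ((B e).smulRight f - (B f).smulRight e) z = 0 := by
  rw [LinearMap.sub_apply, LinearMap.smulRight_apply, LinearMap.smulRight_apply, hez, hfz, zero_smul, zero_smul,
    sub_zero]

/-- `(t_{e,f} - t_{f,e}) e = e` for `⟨e,e⟩ = 0`, `⟨f,e⟩ = -1`. [folklore] -/
private theorem smulRight_sub_smulRight_apply_self {e f : U} (hee : B e e = 0) (hfe : B f e = -1) :
    ((B e).smulRight f - (B f).smulRight e) e = e := by
  rw [LinearMap.sub_apply, LinearMap.smulRight_apply, LinearMap.smulRight_apply, hee, hfe, zero_smul, neg_smul,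
    one_smul, zero_sub, neg_neg]

variable [FiniteDimensional K U]

/-- Fewer than `dim U` linear conditions `⟨v_i, z⟩ = 0` have a non-zero common solution. [folklore] -/
private theorem exists_ne_zero_forall_apply_eq_zero {k : ℕ} (v : Fin k → U) (hk : k < finrank K U) :
    ∃ z : U, z ≠ 0 ∧ ∀ i, B (v i) z = 0 := by
  let Φ : U →ₗ[K] (Fin k → K) := LinearMap.pi fun i ↦ B (v i)
  have h1 := LinearMap.finrank_range_add_finrank_ker Φ
  have h2 : finrank K (LinearMap.range Φ) ≤ k := (Submodule.finrank_le _).trans_eq (Module.finrank_fin_fun K)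
  have h3 : LinearMap.ker Φ ≠ ⊥ := by
    intro h
    rw [h, finrank_bot] at h1
    omega
  obtain ⟨z, hz, hz0⟩ := (Submodule.ne_bot_iff _).1 h3
  refine ⟨z, hz0, fun i ↦ ?_⟩
  have h := congr_fun (LinearMap.mem_ker.1 hz) i
  rwa [LinearMap.pi_apply, Pi.zero_apply] at h

/-- A subspace of more than half the dimension is not totally isotropic (non-degenerate reflexive form). [folklore] -/
private theorem not_forall_apply_eq_zero_of_lt (hB : B.Nondegenerate) (hrefl : B.IsRefl) {W : Submodule K U}
    (hW : finrank K U < 2 * finrank K W) : ¬ ∀ u ∈ W, ∀ v ∈ W, B u v = 0 := by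
  intro h
  have hle : W ≤ B.orthogonal W := fun v hv ↦ LinearMap.BilinForm.mem_orthogonal_iff.2 fun u hu ↦ h u hu v hv
  have hsum := LinearMap.BilinForm.finrank_add_finrank_orthogonal hrefl W
  rw [LinearMap.BilinForm.orthogonal_top_eq_bot hB, inf_bot_eq, finrank_bot, add_zero] at hsum
  have hmono := Submodule.finrank_mono hle
  omega

/-- `dim (x^⊥ ∩ y^⊥) ≥ dim U - 2`. [folklore] -/
private theorem finrank_le_finrank_ker_inf_ker_add_two (x y : U) :
    finrank K U ≤ finrank K ↥(LinearMap.ker (B x) ⊓ LinearMap.ker (B y)) + 2 := by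
  have hx := LinearMap.finrank_range_add_finrank_ker (B x)
  have hy := LinearMap.finrank_range_add_finrank_ker (B y)
  have hx' : finrank K (LinearMap.range (B x)) ≤ 1 := (Submodule.finrank_le _).trans_eq (Module.finrank_self K)
  have hy' : finrank K (LinearMap.range (B y)) ≤ 1 := (Submodule.finrank_le _).trans_eq (Module.finrank_self K)
  have hst := Submodule.finrank_sup_add_finrank_inf_eq (LinearMap.ker (B x)) (LinearMap.ker (B y))
  have hle := Submodule.finrank_le (LinearMap.ker (B x) ⊔ LinearMap.ker (B y))
  omega

/-- `tr (⟨x,x⟩ t_{y,y} + ⟨y,y⟩ t_{x,x}) = 2⟨x,x⟩⟨y,y⟩`. [folklore] -/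
private theorem trace_sq_aux (x y : U) :
    LinearMap.trace K U (B x x • (B y).smulRight y + B y y • (B x).smulRight x) = 2 * (B x x * B y y) := by
  rw [map_add, map_smul, map_smul, LinearMap.trace_smulRight, LinearMap.trace_smulRight, smul_eq_mul, smul_eq_mul]
  ring

/-- **(7.5), last clause, `U` an inner product space (`ε`-symmetric with `ε = 1`) of dimension `≥ 3`, `Y ∈ 𝔤_-(U)`**:
there is a skew `Y` (namely `r_{e₀,e₁}` for orthogonal non-isotropic `e₀, e₁`) whose square is self-adjoint
("`∈ 𝔤_+(U) + 𝔤_0(U)`"), not a scalar, and of non-zero trace. [cite: LooijengaLunts1997, Appendix Lemma (7.5), p. 28 L91–L93] -/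
theorem exists_skewAdjoint_sq_not_mem_span_one_of_symm [CharZero K] (hB : B.Nondegenerate)
    (hsymm : ∀ u u' : U, B u u' = B u' u) (h3 : 3 ≤ finrank K U) :
    ∃ Y ∈ B.skewAdjointSubmodule, B.IsSelfAdjoint ⇑(Y * Y) ∧ Y * Y ∉ K ∙ (1 : Module.End K U) ∧
      LinearMap.trace K U (Y * Y) ≠ 0 := by
  haveI : Invertible (2 : K) := invertibleOfNonzero two_ne_zero
  obtain ⟨e, he⟩ := LinearMap.BilinForm.exists_orthogonal_basis (B := B) ⟨fun x y ↦ hsymm x y⟩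
  have he' : ∀ i j, i ≠ j → B (e i) (e j) = 0 := fun i j hij ↦ he hij
  have hne : ∀ i, B (e i) (e i) ≠ 0 := fun i ↦ he.not_isOrtho_basis_self_of_separatingLeft hB.1 i
  obtain ⟨i₀, i₁, i₂, h01, h02, h12⟩ : ∃ i₀ i₁ i₂ : Fin (finrank K U), i₀ ≠ i₁ ∧ i₀ ≠ i₂ ∧ i₁ ≠ i₂ :=
    ⟨⟨0, by omega⟩, ⟨1, by omega⟩, ⟨2, by omega⟩, by simp [Fin.ext_iff]⟩
  have hskew := isSkewAdjoint_smulRight_sub_smulRight hsymm (e i₀) (e i₁)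
  refine ⟨(B (e i₀)).smulRight (e i₁) - (B (e i₁)).smulRight (e i₀),
    (LinearMap.mem_skewAdjointSubmodule _).2 hskew, isSelfAdjoint_mul_self_of_isSkewAdjoint hskew, ?_, ?_⟩
  · rw [smulRight_sub_smulRight_mul_self (he' _ _ h01) (he' _ _ h01.symm), neg_mem_iff]
    exact not_mem_span_one_of_apply (e.ne_zero i₂) (sq_aux_apply_eq_zero (he' _ _ h02) (he' _ _ h12))
      (by rw [sq_aux_apply_self (he' _ _ h01.symm)]; exact smul_ne_zero (mul_ne_zero (hne i₁) (hne i₀)) (e.ne_zero i₀))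
  · rw [smulRight_sub_smulRight_mul_self (he' _ _ h01) (he' _ _ h01.symm), map_neg, trace_sq_aux, neg_ne_zero]
    exact mul_ne_zero two_ne_zero (mul_ne_zero (hne i₀) (hne i₁))

/-- **(7.5), last clause, `U` an inner product space of dimension `≥ 3`, `Y ∈ 𝔤_+(U)`**: there is a traceless
self-adjoint `Y` (namely `s_{e₀,e₁}`) whose square is self-adjoint, not a scalar, and of non-zero trace.
[cite: LooijengaLunts1997, Appendix Lemma (7.5), p. 28 L91–L93] -/
theorem exists_selfAdjoint_sq_not_mem_span_one_of_symm [CharZero K] (hB : B.Nondegenerate)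
    (hsymm : ∀ u u' : U, B u u' = B u' u) (h3 : 3 ≤ finrank K U) :
    ∃ Y ∈ B.selfAdjointSubmodule ⊓ LinearMap.ker (LinearMap.trace K U), B.IsSelfAdjoint ⇑(Y * Y) ∧
      Y * Y ∉ K ∙ (1 : Module.End K U) ∧ LinearMap.trace K U (Y * Y) ≠ 0 := by
  haveI : Invertible (2 : K) := invertibleOfNonzero two_ne_zero
  obtain ⟨e, he⟩ := LinearMap.BilinForm.exists_orthogonal_basis (B := B) ⟨fun x y ↦ hsymm x y⟩
  have he' : ∀ i j, i ≠ j → B (e i) (e j) = 0 := fun i j hij ↦ he hij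
  have hne : ∀ i, B (e i) (e i) ≠ 0 := fun i ↦ he.not_isOrtho_basis_self_of_separatingLeft hB.1 i
  obtain ⟨i₀, i₁, i₂, h01, h02, h12⟩ : ∃ i₀ i₁ i₂ : Fin (finrank K U), i₀ ≠ i₁ ∧ i₀ ≠ i₂ ∧ i₁ ≠ i₂ :=
    ⟨⟨0, by omega⟩, ⟨1, by omega⟩, ⟨2, by omega⟩, by simp [Fin.ext_iff]⟩
  have hmem := smulRight_add_smulRight_mem hsymm (he' _ _ h01)
  refine ⟨(B (e i₀)).smulRight (e i₁) + (B (e i₁)).smulRight (e i₀), hmem,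
    isSelfAdjoint_mul_self_of_isSelfAdjoint ((LinearMap.mem_selfAdjointSubmodule _).1 hmem.1), ?_, ?_⟩
  · rw [smulRight_add_smulRight_mul_self (he' _ _ h01) (he' _ _ h01.symm)]
    exact not_mem_span_one_of_apply (e.ne_zero i₂) (sq_aux_apply_eq_zero (he' _ _ h02) (he' _ _ h12))
      (by rw [sq_aux_apply_self (he' _ _ h01.symm)]; exact smul_ne_zero (mul_ne_zero (hne i₁) (hne i₀)) (e.ne_zero i₀))
  · rw [smulRight_add_smulRight_mul_self (he' _ _ h01) (he' _ _ h01.symm), trace_sq_aux]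
    exact mul_ne_zero two_ne_zero (mul_ne_zero (hne i₀) (hne i₁))

/-- **(7.5), last clause, `U` symplectic (`ε = -1`) of dimension `≥ 3` (hence `≥ 4`), `Y ∈ 𝔤_-(U) = 𝔰𝔭(U)`**: for a
hyperbolic pair `⟨e, f⟩ = 1`, `Y = t_{e,f} + t_{f,e}` is skew and `Y² = t_{e,f} - t_{f,e}`, the projection onto
`Ke ⊕ Kf` along `{e,f}^⊥`: self-adjoint, not a scalar, of trace `2`. [cite: LooijengaLunts1997, Appendix Lemma (7.5), p. 28 L91–L93] -/
theorem exists_skewAdjoint_sq_not_mem_span_one_of_alt [CharZero K] (hB : B.Nondegenerate)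
    (halt : ∀ u u' : U, B u u' = -B u' u) (h3 : 3 ≤ finrank K U) :
    ∃ Y ∈ B.skewAdjointSubmodule, B.IsSelfAdjoint ⇑(Y * Y) ∧ Y * Y ∉ K ∙ (1 : Module.End K U) ∧
      LinearMap.trace K U (Y * Y) ≠ 0 := by
  have hrefl : B.IsRefl := fun x y hxy ↦ by rw [halt, hxy, neg_zero]
  have hdiag : ∀ w : U, B w w = 0 := fun w ↦ by
    have h := halt w w
    rwa [eq_neg_iff_add_eq_zero, add_self_eq_zero] at h
  obtain ⟨e, -, f, -, hef⟩ := exists_apply_eq_one_of_not_forall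
    (not_forall_apply_eq_zero_of_lt hB hrefl (W := ⊤) (by rw [finrank_top]; omega))
  have hfe : B f e = -1 := by rw [halt, hef]
  have he0 : e ≠ 0 := by
    rintro rfl
    rw [map_zero, LinearMap.zero_apply] at hef
    exact zero_ne_one hef
  obtain ⟨z, hz0, hz⟩ := exists_ne_zero_forall_apply_eq_zero (B := B) ![e, f] (by omega)
  have hez : B e z = 0 := hz 0
  have hfz : B f z = 0 := hz 1
  have hskew := isSkewAdjoint_smulRight_add_smulRight_of_alt halt e f
  have hsq := smulRight_add_smulRight_mul_self_of_pair hef hfe (hdiag e) (hdiag f)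
  refine ⟨(B e).smulRight f + (B f).smulRight e, (LinearMap.mem_skewAdjointSubmodule _).2 hskew,
    isSelfAdjoint_mul_self_of_isSkewAdjoint hskew, ?_, ?_⟩
  · rw [hsq]
    exact not_mem_span_one_of_apply hz0 (smulRight_sub_smulRight_apply_eq_zero hez hfz)
      (by rw [smulRight_sub_smulRight_apply_self (hdiag e) hfe]; exact he0)
  · rw [hsq, trace_smulRight_sub_smulRight halt, hef, mul_one]
    exact two_ne_zero

/-- **(7.5), last clause, `U` symplectic of dimension `≥ 5` (hence `≥ 6`), `Y ∈ 𝔤_+(U)`**: for two orthogonal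
hyperbolic pairs, `Y = P₁ - P₂` (`P_i = t_{e_i,f_i} - t_{f_i,e_i}`) is traceless self-adjoint with `Y² = P₁ + P₂`:
self-adjoint, not a scalar, of trace `4`.  (For `dim U = 4` the clause fails: see the section docstring.)
[cite: LooijengaLunts1997, Appendix Lemma (7.5), p. 28 L91–L93] -/
theorem exists_selfAdjoint_sq_not_mem_span_one_of_alt [CharZero K] (hB : B.Nondegenerate)
    (halt : ∀ u u' : U, B u u' = -B u' u) (h5 : 5 ≤ finrank K U) :
    ∃ Y ∈ B.selfAdjointSubmodule ⊓ LinearMap.ker (LinearMap.trace K U), B.IsSelfAdjoint ⇑(Y * Y) ∧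
      Y * Y ∉ K ∙ (1 : Module.End K U) ∧ LinearMap.trace K U (Y * Y) ≠ 0 := by
  have hrefl : B.IsRefl := fun x y hxy ↦ by rw [halt, hxy, neg_zero]
  have hdiag : ∀ w : U, B w w = 0 := fun w ↦ by
    have h := halt w w
    rwa [eq_neg_iff_add_eq_zero, add_self_eq_zero] at h
  have horth : ∀ {a b : U}, B a b = 0 → B b a = 0 := fun h ↦ by rw [halt, h, neg_zero]
  -- a first hyperbolic pair
  obtain ⟨e₁, -, f₁, -, h₁⟩ := exists_apply_eq_one_of_not_forall
    (not_forall_apply_eq_zero_of_lt hB hrefl (W := ⊤) (by rw [finrank_top]; omega))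
  have h₁' : B f₁ e₁ = -1 := by rw [halt, h₁]
  have he₁ : e₁ ≠ 0 := by
    rintro rfl
    rw [map_zero, LinearMap.zero_apply] at h₁
    exact zero_ne_one h₁
  -- a second one inside `{e₁, f₁}^⊥` (possible as `dim U ≥ 5`)
  obtain ⟨e₂, he₂, f₂, hf₂, h₂⟩ := exists_apply_eq_one_of_not_forall
    (not_forall_apply_eq_zero_of_lt hB hrefl (W := LinearMap.ker (B e₁) ⊓ LinearMap.ker (B f₁))
      (by have := finrank_le_finrank_ker_inf_ker_add_two (B := B) e₁ f₁; omega))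
  have h₂' : B f₂ e₂ = -1 := by rw [halt, h₂]
  have he₁e₂ : B e₁ e₂ = 0 := LinearMap.mem_ker.1 (Submodule.mem_inf.1 he₂).1
  have hf₁e₂ : B f₁ e₂ = 0 := LinearMap.mem_ker.1 (Submodule.mem_inf.1 he₂).2
  have he₁f₂ : B e₁ f₂ = 0 := LinearMap.mem_ker.1 (Submodule.mem_inf.1 hf₂).1
  have hf₁f₂ : B f₁ f₂ = 0 := LinearMap.mem_ker.1 (Submodule.mem_inf.1 hf₂).2
  -- a non-zero vector orthogonal to all four
  obtain ⟨z, hz0, hz⟩ := exists_ne_zero_forall_apply_eq_zero (B := B) ![e₁, f₁, e₂, f₂] (by omega)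
  have he₁z : B e₁ z = 0 := hz 0
  have hf₁z : B f₁ z = 0 := hz 1
  have he₂z : B e₂ z = 0 := hz 2
  have hf₂z : B f₂ z = 0 := hz 3
  -- membership of `P_i` in the self-adjoint operators, and traces
  have hsa : ∀ e f : U, (B e).smulRight f - (B f).smulRight e ∈ B.selfAdjointSubmodule := fun e f ↦
    (LinearMap.mem_selfAdjointSubmodule _).2 (isSelfAdjoint_smulRight_sub_smulRight halt e f)
  have hY : (B e₁).smulRight f₁ - (B f₁).smulRight e₁ - ((B e₂).smulRight f₂ - (B f₂).smulRight e₂) ∈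
      B.selfAdjointSubmodule ⊓ LinearMap.ker (LinearMap.trace K U) := by
    refine ⟨B.selfAdjointSubmodule.sub_mem (hsa e₁ f₁) (hsa e₂ f₂), LinearMap.mem_ker.2 ?_⟩
    rw [map_sub, trace_smulRight_sub_smulRight halt, trace_smulRight_sub_smulRight halt, h₁, h₂, sub_self]
  have h11 := smulRight_sub_smulRight_mul_self_of_pair h₁ h₁' (hdiag e₁) (hdiag f₁)
  have h22 := smulRight_sub_smulRight_mul_self_of_pair h₂ h₂' (hdiag e₂) (hdiag f₂)
  have h12 := smulRight_sub_smulRight_mul_eq_zero he₁f₂ he₁e₂ hf₁f₂ hf₁e₂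
  have h21 := smulRight_sub_smulRight_mul_eq_zero (horth hf₁e₂) (horth he₁e₂) (horth hf₁f₂) (horth he₁f₂)
  have hsq : ((B e₁).smulRight f₁ - (B f₁).smulRight e₁ - ((B e₂).smulRight f₂ - (B f₂).smulRight e₂)) *
      ((B e₁).smulRight f₁ - (B f₁).smulRight e₁ - ((B e₂).smulRight f₂ - (B f₂).smulRight e₂)) =
      ((B e₁).smulRight f₁ - (B f₁).smulRight e₁) + ((B e₂).smulRight f₂ - (B f₂).smulRight e₂) := by
    set P₁ : Module.End K U := (B e₁).smulRight f₁ - (B f₁).smulRight e₁ with hP₁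
    set P₂ : Module.End K U := (B e₂).smulRight f₂ - (B f₂).smulRight e₂ with hP₂
    clear_value P₁ P₂
    rw [sub_mul, mul_sub, mul_sub, h11, h22, h12, h21]
    abel
  refine ⟨_, hY, isSelfAdjoint_mul_self_of_isSelfAdjoint ((LinearMap.mem_selfAdjointSubmodule _).1 hY.1), ?_, ?_⟩
  · rw [hsq]
    refine not_mem_span_one_of_apply hz0 ?_ (w := e₁) ?_
    · rw [LinearMap.add_apply, smulRight_sub_smulRight_apply_eq_zero he₁z hf₁z,
        smulRight_sub_smulRight_apply_eq_zero he₂z hf₂z, add_zero]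
    · rw [LinearMap.add_apply, smulRight_sub_smulRight_apply_self (hdiag e₁) h₁',
        smulRight_sub_smulRight_apply_eq_zero (horth he₁e₂) (horth he₁f₂), add_zero]
      exact he₁
  · rw [hsq, map_add, trace_smulRight_sub_smulRight halt, trace_smulRight_sub_smulRight halt, h₁, h₂]
    norm_num

/-- **(7.5), last clause for `𝔤_-(U)`**: for a non-degenerate `ε`-symmetric form (`ε² = 1`) on `U` of dimension
`≥ 3` (characteristic `0`) there is `Y ∈ 𝔤_-(U) = 𝔞𝔲𝔱(U)` with `Y²` self-adjoint ("`∈ 𝔤_+(U) + 𝔤_0(U)`"), not a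
scalar, and of non-zero trace. [cite: LooijengaLunts1997, Appendix Lemma (7.5), p. 28 L91–L93] -/
theorem exists_skewAdjoint_sq_not_mem_span_one [CharZero K] (hB : B.Nondegenerate) {ε : K}
    (hflip : ∀ u u' : U, B u' u = ε * B u u') (hε : ε * ε = 1) (h3 : 3 ≤ finrank K U) :
    ∃ Y ∈ B.skewAdjointSubmodule, B.IsSelfAdjoint ⇑(Y * Y) ∧ Y * Y ∉ K ∙ (1 : Module.End K U) ∧
      LinearMap.trace K U (Y * Y) ≠ 0 := by
  rcases mul_self_eq_one_iff.1 hε with rfl | rfl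
  · exact exists_skewAdjoint_sq_not_mem_span_one_of_symm hB (fun u u' ↦ by rw [hflip u' u, one_mul]) h3
  · exact exists_skewAdjoint_sq_not_mem_span_one_of_alt hB (fun u u' ↦ by rw [hflip u' u, neg_one_mul]) h3

/-- **(7.5), last clause for `𝔤_+(U)`, in dimension `≥ 5`**: for a non-degenerate `ε`-symmetric form (`ε² = 1`) on
`U` of dimension `≥ 5` (characteristic `0`) there is `Y ∈ 𝔤_+(U)` with `Y²` self-adjoint, not a scalar, and of
non-zero trace.  For an inner product space `dim U ≥ 3` suffices (`exists_selfAdjoint_sq_not_mem_span_one_of_symm`);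
for a symplectic `U` the printed "`dim U > 2`" over-claims: in dimension `4` every `Y ∈ 𝔤_+(U)` has a scalar
square (SCOPE (b); not formalised). [cite: LooijengaLunts1997, Appendix Lemma (7.5), p. 28 L91–L93] -/
theorem exists_selfAdjoint_sq_not_mem_span_one [CharZero K] (hB : B.Nondegenerate) {ε : K}
    (hflip : ∀ u u' : U, B u' u = ε * B u u') (hε : ε * ε = 1) (h5 : 5 ≤ finrank K U) :
    ∃ Y ∈ B.selfAdjointSubmodule ⊓ LinearMap.ker (LinearMap.trace K U), B.IsSelfAdjoint ⇑(Y * Y) ∧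
      Y * Y ∉ K ∙ (1 : Module.End K U) ∧ LinearMap.trace K U (Y * Y) ≠ 0 := by
  rcases mul_self_eq_one_iff.1 hε with rfl | rfl
  · exact exists_selfAdjoint_sq_not_mem_span_one_of_symm hB (fun u u' ↦ by rw [hflip u' u, one_mul]) (by omega)
  · exact exists_selfAdjoint_sq_not_mem_span_one_of_alt hB (fun u u' ↦ by rw [hflip u' u, neg_one_mul]) h5

end SquareNotScalar


/-! ### §8 (rider A1-163) The symplectic plane and the symplectic `4`-space: `𝔤_+(U) = 0` in dimension `2`, and in
dimension `4` every `Y ∈ 𝔤_+(U)` has a SCALAR square — the printed last clause of (7.5) fails there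

For an antisymmetric non-degenerate `B` an operator `Y` is `B`-self-adjoint iff its matrix `W` in a symplectic
basis satisfies `WJ = -(WJ)ᵀ` ("skew-Hamiltonian" [LiuZhangFerreiraRalha2012, Def. 2.8 (2)]), i.e.
`W = [A G; F Aᵀ]` with `G`, `F` antisymmetric.  For `n = 1` this forces `W = a · 1`; for `n = 2`, `G = g·j`,
`F = f·j` (`j = [0 1; -1 0]`) and `2 × 2` Cayley–Hamilton give `W² = (tr A) W - (det A + g f) · 1`, so a TRACELESS
self-adjoint `Y` has `Y² ∈ K · 1`.  Below this is carried out inside `U` (no matrices): two orthogonal hyperbolic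
pairs `⟨e_i, f_i⟩ = 1` give `1 = P₁ + P₂` (`P_i = t_{e_i,f_i} - t_{f_i,e_i}`), the six values
`α = ⟨e₁, Y f₁⟩, β = ⟨e₂, Y f₂⟩, p = ⟨e₁, Y e₂⟩, q = ⟨e₁, Y f₂⟩, r = ⟨f₁, Y e₂⟩, s = ⟨f₁, Y f₂⟩` are the free
entries of `W` (`⟨x, Y x⟩ = 0`, `⟨x, Y y⟩ = -⟨y, Y x⟩`), and `Y² = (α + β) Y + (ps - qr - αβ) · 1`, `tr Y = 2(α + β)`. -/

section SymplecticSmall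

variable {K : Type*} [Field K] {U : Type*} [AddCommGroup U] [Module K U] {B : BilinForm K U}

/-- Composition with a rank-one operator: `Y ∘ t_{x,y} = t_{x, Y y}`. [folklore] -/
private theorem mul_smulRight_eq (Y : Module.End K U) (x y : U) :
    Y * (B x).smulRight y = (B x).smulRight (Y y) := by
  ext w
  simp only [Module.End.mul_apply, LinearMap.smulRight_apply, map_smul]

/-- `⟨x, Y x⟩ = 0` for a self-adjoint `Y` and an antisymmetric form (characteristic `0`). [folklore] -/
private theorem apply_self_apply_eq_zero_of_isSelfAdjoint [CharZero K] (halt : ∀ u u' : U, B u u' = -B u' u)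
    {Y : Module.End K U} (hY : B.IsSelfAdjoint ⇑Y) (x : U) : B x (Y x) = 0 := by
  have h : B x (Y x) = -B x (Y x) := by
    conv_lhs => rw [← hY x x, halt]
  rwa [eq_neg_iff_add_eq_zero, add_self_eq_zero] at h

/-- `⟨x, Y y⟩ = -⟨y, Y x⟩` for a self-adjoint `Y` and an antisymmetric form. [folklore] -/
private theorem apply_apply_eq_neg_of_isSelfAdjoint (halt : ∀ u u' : U, B u u' = -B u' u)
    {Y : Module.End K U} (hY : B.IsSelfAdjoint ⇑Y) (x y : U) : B x (Y y) = -B y (Y x) := by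
  rw [← hY y x, halt]

variable [FiniteDimensional K U]

omit [FiniteDimensional K U] in
/-- **A hyperbolic basis of a symplectic plane spans**: for an antisymmetric form with `⟨e, f⟩ = 1` on a space of
dimension `2`, every `w` is `⟨e, w⟩ f - ⟨f, w⟩ e` ("`t_{e,f} - t_{f,e} = 1`"). [folklore] -/
private theorem eq_pair_of_finrank_two [CharZero K] (halt : ∀ u u' : U, B u u' = -B u' u)
    (h2 : finrank K U = 2) {e f : U} (hef : B e f = 1) (w : U) : w = B e w • f - B f w • e := by
  have hdiag : ∀ w : U, B w w = 0 := fun w ↦ by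
    have h := halt w w
    rwa [eq_neg_iff_add_eq_zero, add_self_eq_zero] at h
  have hfe : B f e = -1 := by rw [halt, hef]
  -- `e, f` are linearly independent (pair with `⟨e, ·⟩`, `⟨f, ·⟩`), hence a basis
  have hli : LinearIndependent K ![e, f] := by
    refine Fintype.linearIndependent_iff.2 fun g hg i ↦ ?_
    rw [Fin.sum_univ_two] at hg
    simp only [Matrix.cons_val_zero, Matrix.cons_val_one] at hg
    have h0 := congr_arg (B f) hg
    have h1 := congr_arg (B e) hg
    simp only [map_add, map_smul, smul_eq_mul, hdiag, hef, hfe, map_zero, mul_zero, mul_one, zero_add,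
      add_zero, mul_neg, neg_eq_zero] at h0 h1
    fin_cases i
    · exact h0
    · exact h1
  have hcard : Fintype.card (Fin 2) = finrank K U := by rw [Fintype.card_fin, h2]
  set P : Module.End K U := (B e).smulRight f - (B f).smulRight e with hP
  have hP1 : P = 1 := by
    refine (basisOfLinearIndependentOfCardEqFinrank hli hcard).ext fun i ↦ ?_
    rw [coe_basisOfLinearIndependentOfCardEqFinrank]
    fin_cases i <;>
      simp [hP, LinearMap.sub_apply, LinearMap.smulRight_apply, hdiag, hef, hfe]
  have h := LinearMap.congr_fun hP1 w
  rw [hP, LinearMap.sub_apply, LinearMap.smulRight_apply, LinearMap.smulRight_apply, Module.End.one_apply] at h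
  exact h.symm

/-- **`𝔤_+(U) = 0` for a symplectic PLANE: on a `2`-dimensional space with a non-degenerate antisymmetric form
(characteristic `0`) the self-adjoint operators are exactly the scalars** — the `n = 1` case of the block form
`W = [A G; F Aᵀ]`, `G = -Gᵀ`, `F = -Fᵀ` of a "skew-Hamiltonian" (`= ω`-self-adjoint) matrix.  So in (7.5)
(which assumes `dim U ≥ 2`) the summand `𝔤_+(U)` is absent for the symplectic plane, `𝔤𝔩(U) = 𝔰𝔭(U) ⊕ 𝔤_0(U)`.
[cite: LooijengaLunts1997, Appendix Lemma (7.5), p. 28 L80–L89; LiuZhangFerreiraRalha2012, Def. 2.8 (2), p. 5] -/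
theorem isSelfAdjoint_iff_mem_span_one_of_alt_finrank_two [CharZero K] (hB : B.Nondegenerate)
    (halt : ∀ u u' : U, B u u' = -B u' u) (h2 : finrank K U = 2) (Y : Module.End K U) :
    B.IsSelfAdjoint ⇑Y ↔ Y ∈ K ∙ (1 : Module.End K U) := by
  constructor
  · intro hY
    have hrefl : B.IsRefl := fun x y hxy ↦ by rw [halt, hxy, neg_zero]
    obtain ⟨e, -, f, -, hef⟩ := exists_apply_eq_one_of_not_forall
      (not_forall_apply_eq_zero_of_lt hB hrefl (W := ⊤) (by rw [finrank_top]; omega))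
    have hw := eq_pair_of_finrank_two halt h2 hef
    have d := apply_self_apply_eq_zero_of_isSelfAdjoint halt hY
    have n := apply_apply_eq_neg_of_isSelfAdjoint halt hY
    -- the coordinates of `Y e`, `Y f`: `Y e = ⟨e, Y f⟩ e`, `Y f = ⟨e, Y f⟩ f`
    have hYe : Y e = B e (Y f) • e := by
      conv_lhs => rw [hw (Y e), d e, n f e]
      module
    have hYf : Y f = B e (Y f) • f := by
      conv_lhs => rw [hw (Y f), d f]
      module
    refine Submodule.mem_span_singleton.2 ⟨B e (Y f), LinearMap.ext fun w ↦ ?_⟩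
    rw [LinearMap.smul_apply, Module.End.one_apply]
    -- goal: `⟨e, Y f⟩ • w = Y w`
    conv_lhs => rw [hw w]
    conv_rhs => rw [hw w, map_sub, map_smul, map_smul, hYf, hYe]
    module
  · intro hY
    obtain ⟨c, rfl⟩ := Submodule.mem_span_singleton.1 hY
    exact isSelfAdjoint_smul_one B c

/-- **`𝔤_+(U) = sym_B(U) ∩ 𝔰𝔩(U) = 0` for a symplectic plane** (the traceless scalars vanish in characteristic
`0`). [cite: LooijengaLunts1997, Appendix Lemma (7.5), p. 28 L80–L89] -/
theorem selfAdjointSubmodule_inf_ker_trace_eq_bot_of_alt_finrank_two [CharZero K] (hB : B.Nondegenerate)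
    (halt : ∀ u u' : U, B u u' = -B u' u) (h2 : finrank K U = 2) :
    B.selfAdjointSubmodule ⊓ LinearMap.ker (LinearMap.trace K U) = ⊥ := by
  refine (Submodule.eq_bot_iff _).2 fun Y hY ↦ ?_
  obtain ⟨hYs, hYt⟩ := Submodule.mem_inf.1 hY
  obtain ⟨c, rfl⟩ := Submodule.mem_span_singleton.1
    ((isSelfAdjoint_iff_mem_span_one_of_alt_finrank_two hB halt h2 Y).1
      ((LinearMap.mem_selfAdjointSubmodule _).1 hYs))
  have h := LinearMap.mem_ker.1 hYt
  rw [map_smul, LinearMap.trace_one, h2, smul_eq_mul, mul_eq_zero] at h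
  rcases h with h | h
  · rw [h, zero_smul]
  · norm_num at h

/-- **Two orthogonal hyperbolic pairs in a symplectic `4`-space**: `⟨e₁, f₁⟩ = ⟨e₂, f₂⟩ = 1`, `e₁, f₁ ⊥ e₂, f₂`.
[folklore] -/
private theorem exists_hyperbolic_pairs_of_finrank_four [CharZero K] (hB : B.Nondegenerate)
    (halt : ∀ u u' : U, B u u' = -B u' u) (h4 : finrank K U = 4) :
    ∃ e₁ f₁ e₂ f₂ : U, B e₁ f₁ = 1 ∧ B e₂ f₂ = 1 ∧ B e₁ e₂ = 0 ∧ B e₁ f₂ = 0 ∧ B f₁ e₂ = 0 ∧ B f₁ f₂ = 0 := by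
  have hrefl : B.IsRefl := fun x y hxy ↦ by rw [halt, hxy, neg_zero]
  have hdiag : ∀ w : U, B w w = 0 := fun w ↦ by
    have h := halt w w
    rwa [eq_neg_iff_add_eq_zero, add_self_eq_zero] at h
  obtain ⟨e₁, -, f₁, -, h₁⟩ := exists_apply_eq_one_of_not_forall
    (not_forall_apply_eq_zero_of_lt hB hrefl (W := ⊤) (by rw [finrank_top]; omega))
  have h₁' : B f₁ e₁ = -1 := by rw [halt, h₁]
  set W : Submodule K U := LinearMap.ker (B e₁) ⊓ LinearMap.ker (B f₁) with hW
  -- `W = {e₁, f₁}^⊥` is non-zero and the form does not vanish on it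
  have hWpos : W ≠ ⊥ := by
    intro h
    have := finrank_le_finrank_ker_inf_ker_add_two (B := B) e₁ f₁
    rw [← hW, h, finrank_bot] at this
    omega
  obtain ⟨w, hwW, hw0⟩ := (Submodule.ne_bot_iff _).1 hWpos
  have hW' : ¬ ∀ u ∈ W, ∀ v ∈ W, B u v = 0 := by
    intro h
    apply hw0
    refine hB.1 w fun v ↦ ?_
    have he₁w : B e₁ w = 0 := LinearMap.mem_ker.1 (Submodule.mem_inf.1 hwW).1
    have hf₁w : B f₁ w = 0 := LinearMap.mem_ker.1 (Submodule.mem_inf.1 hwW).2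
    -- project `v` into `W` along the hyperbolic plane
    have hv' : v - B e₁ v • f₁ + B f₁ v • e₁ ∈ W := by
      refine Submodule.mem_inf.2 ⟨LinearMap.mem_ker.2 ?_, LinearMap.mem_ker.2 ?_⟩
      · rw [map_add, map_sub, map_smul, map_smul, smul_eq_mul, smul_eq_mul, h₁, hdiag, mul_one, mul_zero,
          sub_self, zero_add]
      · rw [map_add, map_sub, map_smul, map_smul, smul_eq_mul, smul_eq_mul, h₁', hdiag, mul_zero, sub_zero,
          mul_neg, mul_one, add_neg_cancel]
    have h0 := h w hwW _ hv'
    rwa [map_add, map_sub, map_smul, map_smul, smul_eq_mul, smul_eq_mul, halt w f₁, hf₁w, halt w e₁, he₁w,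
      neg_zero, mul_zero, mul_zero, sub_zero, add_zero] at h0
  obtain ⟨e₂, he₂, f₂, hf₂, h₂⟩ := exists_apply_eq_one_of_not_forall hW'
  exact ⟨e₁, f₁, e₂, f₂, h₁, h₂, LinearMap.mem_ker.1 (Submodule.mem_inf.1 he₂).1,
    LinearMap.mem_ker.1 (Submodule.mem_inf.1 hf₂).1, LinearMap.mem_ker.1 (Submodule.mem_inf.1 he₂).2,
    LinearMap.mem_ker.1 (Submodule.mem_inf.1 hf₂).2⟩

omit [FiniteDimensional K U] in
/-- **Two orthogonal hyperbolic pairs span a symplectic `4`-space**: `t_{e₁,f₁} - t_{f₁,e₁} + t_{e₂,f₂} - t_{f₂,e₂} = 1`,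
pointwise. [folklore] -/
private theorem eq_pairs_of_finrank_four [CharZero K] (halt : ∀ u u' : U, B u u' = -B u' u)
    (h4 : finrank K U = 4) {e₁ f₁ e₂ f₂ : U} (h₁ : B e₁ f₁ = 1) (h₂ : B e₂ f₂ = 1) (h12 : B e₁ e₂ = 0)
    (h12' : B e₁ f₂ = 0) (h1'2 : B f₁ e₂ = 0) (h1'2' : B f₁ f₂ = 0) (w : U) :
    w = B e₁ w • f₁ - B f₁ w • e₁ + (B e₂ w • f₂ - B f₂ w • e₂) := by
  have hdiag : ∀ w : U, B w w = 0 := fun w ↦ by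
    have h := halt w w
    rwa [eq_neg_iff_add_eq_zero, add_self_eq_zero] at h
  have h₁' : B f₁ e₁ = -1 := by rw [halt, h₁]
  have h₂' : B f₂ e₂ = -1 := by rw [halt, h₂]
  have h21 : B e₂ e₁ = 0 := by rw [halt, h12, neg_zero]
  have h2'1 : B f₂ e₁ = 0 := by rw [halt, h12', neg_zero]
  have h21' : B e₂ f₁ = 0 := by rw [halt, h1'2, neg_zero]
  have h2'1' : B f₂ f₁ = 0 := by rw [halt, h1'2', neg_zero]
  have hli : LinearIndependent K ![e₁, f₁, e₂, f₂] := by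
    refine Fintype.linearIndependent_iff.2 fun g hg i ↦ ?_
    rw [Fin.sum_univ_four] at hg
    simp only [Matrix.cons_val_zero, Matrix.cons_val_one, Matrix.cons_val] at hg
    have ha := congr_arg (B f₁) hg
    have hb := congr_arg (B e₁) hg
    have hc := congr_arg (B f₂) hg
    have hd := congr_arg (B e₂) hg
    simp only [map_add, map_smul, smul_eq_mul, hdiag, h₁, h₁', h₂, h₂', h12, h12', h1'2, h1'2', h21, h2'1, h21',
      h2'1', map_zero, mul_zero, mul_one, zero_add, add_zero, mul_neg, neg_eq_zero] at ha hb hc hd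
    fin_cases i
    · exact ha
    · exact hb
    · exact hc
    · exact hd
  have hcard : Fintype.card (Fin 4) = finrank K U := by rw [Fintype.card_fin, h4]
  set Q : Module.End K U := (B e₁).smulRight f₁ - (B f₁).smulRight e₁ + ((B e₂).smulRight f₂ - (B f₂).smulRight e₂)
    with hQ
  have hQ1 : Q = 1 := by
    refine (basisOfLinearIndependentOfCardEqFinrank hli hcard).ext fun i ↦ ?_
    rw [coe_basisOfLinearIndependentOfCardEqFinrank]
    fin_cases i <;>
      simp [hQ, LinearMap.sub_apply, LinearMap.add_apply, LinearMap.smulRight_apply, hdiag, h₁, h₁', h₂, h₂', h12,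
        h12', h1'2, h1'2', h21, h2'1, h21', h2'1']
  have h := LinearMap.congr_fun hQ1 w
  rw [hQ, LinearMap.add_apply, LinearMap.sub_apply, LinearMap.sub_apply, LinearMap.smulRight_apply,
    LinearMap.smulRight_apply, LinearMap.smulRight_apply, LinearMap.smulRight_apply, Module.End.one_apply] at h
  exact h.symm

/-- **The quadratic identity in coordinates**: for two orthogonal hyperbolic pairs spanning `U` and a self-adjoint
`Y` (antisymmetric form), with `α = ⟨e₁, Y f₁⟩`, `β = ⟨e₂, Y f₂⟩`, `p = ⟨e₁, Y e₂⟩`, `q = ⟨e₁, Y f₂⟩`,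
`r = ⟨f₁, Y e₂⟩`, `s = ⟨f₁, Y f₂⟩`: `Y² = (α + β) Y + (ps - qr - αβ) · 1` and `tr Y = 2(α + β)` — the `n = 2`
skew-Hamiltonian block form `[A G; F Aᵀ]` (`A = [α -r; q β]`, `G = -s·j`, `F = p·j`) and `2 × 2` Cayley–Hamilton.
[folklore] -/
private theorem mul_self_eq_of_pairs [CharZero K] (halt : ∀ u u' : U, B u u' = -B u' u)
    (h4 : finrank K U = 4) {e₁ f₁ e₂ f₂ : U} (h₁ : B e₁ f₁ = 1) (h₂ : B e₂ f₂ = 1) (h12 : B e₁ e₂ = 0)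
    (h12' : B e₁ f₂ = 0) (h1'2 : B f₁ e₂ = 0) (h1'2' : B f₁ f₂ = 0) {Y : Module.End K U}
    (hY : B.IsSelfAdjoint ⇑Y) :
    Y * Y = (B e₁ (Y f₁) + B e₂ (Y f₂)) • Y +
        (B e₁ (Y e₂) * B f₁ (Y f₂) - B e₁ (Y f₂) * B f₁ (Y e₂) - B e₁ (Y f₁) * B e₂ (Y f₂)) •
          (1 : Module.End K U) ∧
      LinearMap.trace K U Y = 2 * (B e₁ (Y f₁) + B e₂ (Y f₂)) := by
  have hw := eq_pairs_of_finrank_four halt h4 h₁ h₂ h12 h12' h1'2 h1'2'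
  -- the sixteen values `⟨b, Y b'⟩`
  set α := B e₁ (Y f₁) with hα
  set β := B e₂ (Y f₂) with hβ
  set p := B e₁ (Y e₂) with hp
  set q := B e₁ (Y f₂) with hq
  set r := B f₁ (Y e₂) with hr
  set s := B f₁ (Y f₂) with hs
  have d := apply_self_apply_eq_zero_of_isSelfAdjoint halt hY
  have n := apply_apply_eq_neg_of_isSelfAdjoint halt hY
  have hYe₁ : Y e₁ = α • e₁ + q • e₂ - p • f₂ := by
    rw [hw (Y e₁), d e₁, n f₁ e₁, n e₂ e₁, n f₂ e₁]
    module
  have hYf₁ : Y f₁ = α • f₁ + s • e₂ - r • f₂ := by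
    rw [hw (Y f₁), d f₁, n e₂ f₁, n f₂ f₁]
    module
  have hYe₂ : Y e₂ = -r • e₁ + p • f₁ + β • e₂ := by
    rw [hw (Y e₂), d e₂, n f₂ e₂]
    module
  have hYf₂ : Y f₂ = -s • e₁ + q • f₁ + β • f₂ := by
    rw [hw (Y f₂), d f₂]
    module
  refine ⟨LinearMap.ext fun w ↦ ?_, ?_⟩
  · obtain ⟨c₁, c₂, c₃, c₄, rfl⟩ : ∃ c₁ c₂ c₃ c₄ : K, w = c₁ • f₁ - c₂ • e₁ + (c₃ • f₂ - c₄ • e₂) :=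
      ⟨_, _, _, _, hw w⟩
    simp only [Module.End.mul_apply, LinearMap.add_apply, LinearMap.smul_apply, Module.End.one_apply, map_add,
      map_sub, map_smul, hYe₁, hYf₁, hYe₂, hYf₂, smul_add, smul_sub, smul_smul]
    module
  · -- `tr Y = tr (Y Q) = ⟨e₁, Y f₁⟩ - ⟨f₁, Y e₁⟩ + ⟨e₂, Y f₂⟩ - ⟨f₂, Y e₂⟩`
    have hQ : (B e₁).smulRight f₁ - (B f₁).smulRight e₁ + ((B e₂).smulRight f₂ - (B f₂).smulRight e₂) =
        (1 : Module.End K U) := by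
      ext w
      rw [LinearMap.add_apply, LinearMap.sub_apply, LinearMap.sub_apply, LinearMap.smulRight_apply,
        LinearMap.smulRight_apply, LinearMap.smulRight_apply, LinearMap.smulRight_apply, Module.End.one_apply]
      exact (hw w).symm
    have hYQ : Y = Y * ((B e₁).smulRight f₁ - (B f₁).smulRight e₁ + ((B e₂).smulRight f₂ - (B f₂).smulRight e₂)) := by
      rw [hQ, mul_one]
    rw [hYQ, mul_add, mul_sub, mul_sub, mul_smulRight_eq, mul_smulRight_eq, mul_smulRight_eq, mul_smulRight_eq,
      map_add, map_sub, map_sub, LinearMap.trace_smulRight, LinearMap.trace_smulRight, LinearMap.trace_smulRight,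
      LinearMap.trace_smulRight, n f₁ e₁, n f₂ e₂]
    ring

/-- **The symplectic `4`-space: every self-adjoint `Y` satisfies a quadratic equation `Y² = a Y + c · 1` with
`2a = tr Y`** — for a non-degenerate antisymmetric form on `U` of dimension `4` (characteristic `0`).  This is the
`n = 2` case of the block form of an `ω`-self-adjoint ("skew-Hamiltonian") matrix, `W = [A G; F Aᵀ]` with `G`, `F`
antisymmetric, hence multiples of `j = [0 1; -1 0]`, combined with Cayley–Hamilton for the `2 × 2` block `A`:
`W² = (tr A) W - (det A + g f) · 1`; equivalently `Y`'s minimal polynomial has degree `≤ 2` (all eigenvalue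
multiplicities are even).  Compare A1-39 `PluckerQuadricCliffordAlgebra` (the `8`-dimensional analogue
`A_u² ∈ K` on `V ⊕ V^*`). [cite: LiuZhangFerreiraRalha2012, Def. 2.8 (2), p. 5; LooijengaLunts1997, Appendix Lemma (7.5), p. 28 L91–L93] -/
theorem exists_mul_self_eq_smul_add_smul_one_of_isSelfAdjoint_of_alt_finrank_four [CharZero K]
    (hB : B.Nondegenerate) (halt : ∀ u u' : U, B u u' = -B u' u) (h4 : finrank K U = 4) {Y : Module.End K U}
    (hY : B.IsSelfAdjoint ⇑Y) :
    ∃ a c : K, Y * Y = a • Y + c • (1 : Module.End K U) ∧ LinearMap.trace K U Y = 2 * a := by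
  obtain ⟨e₁, f₁, e₂, f₂, h₁, h₂, h12, h12', h1'2, h1'2'⟩ := exists_hyperbolic_pairs_of_finrank_four hB halt h4
  obtain ⟨hsq, htr⟩ := mul_self_eq_of_pairs halt h4 h₁ h₂ h12 h12' h1'2 h1'2' hY
  exact ⟨_, _, hsq, htr⟩

/-- … hence `Y² - ½ (tr Y) Y ∈ 𝔤_0(U) = K · 1` for every self-adjoint `Y` on a symplectic `4`-space.
[cite: LiuZhangFerreiraRalha2012, Def. 2.8 (2), p. 5; LooijengaLunts1997, Appendix Lemma (7.5), p. 28 L91–L93] -/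
theorem mul_self_sub_smul_mem_span_one_of_isSelfAdjoint_of_alt_finrank_four [CharZero K]
    (hB : B.Nondegenerate) (halt : ∀ u u' : U, B u u' = -B u' u) (h4 : finrank K U = 4) {Y : Module.End K U}
    (hY : B.IsSelfAdjoint ⇑Y) :
    Y * Y - ((2 : K)⁻¹ * LinearMap.trace K U Y) • Y ∈ K ∙ (1 : Module.End K U) := by
  obtain ⟨a, c, hsq, htr⟩ := exists_mul_self_eq_smul_add_smul_one_of_isSelfAdjoint_of_alt_finrank_four hB halt h4 hY
  refine Submodule.mem_span_singleton.2 ⟨c, ?_⟩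
  rw [hsq, htr, ← mul_assoc, inv_mul_cancel₀ (two_ne_zero' K), one_mul, add_sub_cancel_left]

/-- **The dimension-`4` symplectic exception to (7.5)'s last clause: every `Y ∈ 𝔤_+(U)` has a SCALAR square.**
For a non-degenerate antisymmetric form on `U` with `dim U = 4` (characteristic `0`) and every traceless
self-adjoint `Y`, `Y² ∈ K · 1 = 𝔤_0(U)`.  Consequently the printed "If `dim U > 2`, then … for `ε = ±`, there
exists `Y ∈ 𝔤_ε(U)` such that `Y² ∈ 𝔤_+(U) + 𝔤_0(U)` is not a scalar" FAILS for `ε = +` and `U` symplectic of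
dimension `4` (and only there among `dim U > 2`: §7 gives such `Y` for symplectic `dim U ≥ 6` and for inner
product spaces of `dim ≥ 3`); the mechanism is `𝔤_+(U) ≅ Λ²₀U`, the `5`-dimensional orthogonal representation of
`𝔰𝔭(4) ≅ 𝔰𝔬(5)`, on which `Y ↦ Y²` is the invariant quadratic form.  This theorem records the correction; the
printed clause is cited as its locus, not as its source. [cite: LooijengaLunts1997, Appendix Lemma (7.5), p. 28 L91–L93; LiuZhangFerreiraRalha2012, Def. 2.8 (2), p. 5] -/
theorem mul_self_mem_span_one_of_mem_selfAdjointSubmodule_inf_ker_trace_of_alt_finrank_four [CharZero K]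
    (hB : B.Nondegenerate) (halt : ∀ u u' : U, B u u' = -B u' u) (h4 : finrank K U = 4) {Y : Module.End K U}
    (hY : Y ∈ B.selfAdjointSubmodule ⊓ LinearMap.ker (LinearMap.trace K U)) :
    Y * Y ∈ K ∙ (1 : Module.End K U) := by
  obtain ⟨hYs, hYt⟩ := Submodule.mem_inf.1 hY
  have h := mul_self_sub_smul_mem_span_one_of_isSelfAdjoint_of_alt_finrank_four hB halt h4
    ((LinearMap.mem_selfAdjointSubmodule _).1 hYs)
  rwa [LinearMap.mem_ker.1 hYt, mul_zero, zero_smul, sub_zero] at h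

/-- **(7.5), last clause, is FALSE for `𝔤_+(U)` of a symplectic `4`-space**: there is NO traceless self-adjoint
`Y` with `Y²` not a scalar (so the hypothesis `5 ≤ finrank K U` of `exists_selfAdjoint_sq_not_mem_span_one_of_alt`
is optimal, dimensions of symplectic spaces being even). [cite: LooijengaLunts1997, Appendix Lemma (7.5), p. 28 L91–L93] -/
theorem not_exists_selfAdjoint_sq_not_mem_span_one_of_alt_finrank_four [CharZero K] (hB : B.Nondegenerate)
    (halt : ∀ u u' : U, B u u' = -B u' u) (h4 : finrank K U = 4) :
    ¬ ∃ Y ∈ B.selfAdjointSubmodule ⊓ LinearMap.ker (LinearMap.trace K U), Y * Y ∉ K ∙ (1 : Module.End K U) := by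
  rintro ⟨Y, hY, hYY⟩
  exact hYY (mul_self_mem_span_one_of_mem_selfAdjointSubmodule_inf_ker_trace_of_alt_finrank_four hB halt h4 hY)

/-- **The Clifford relations on `𝔤_+(U)` of a symplectic `4`-space**: `Y Z + Z Y ∈ K · 1` for all traceless
self-adjoint `Y`, `Z` (polarisation of `Y² ∈ K · 1`) — the invariant symmetric form of the `5`-dimensional
representation `𝔤_+(U)` of `𝔰𝔭(U) ≅ 𝔰𝔬(5)`. [cite: LooijengaLunts1997, Appendix Lemma (7.5), p. 28 L88–L93] -/
theorem mul_add_mul_mem_span_one_of_mem_selfAdjointSubmodule_inf_ker_trace_of_alt_finrank_four [CharZero K]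
    (hB : B.Nondegenerate) (halt : ∀ u u' : U, B u u' = -B u' u) (h4 : finrank K U = 4) {Y Z : Module.End K U}
    (hY : Y ∈ B.selfAdjointSubmodule ⊓ LinearMap.ker (LinearMap.trace K U))
    (hZ : Z ∈ B.selfAdjointSubmodule ⊓ LinearMap.ker (LinearMap.trace K U)) :
    Y * Z + Z * Y ∈ K ∙ (1 : Module.End K U) := by
  have hYZ := mul_self_mem_span_one_of_mem_selfAdjointSubmodule_inf_ker_trace_of_alt_finrank_four hB halt h4
    (Submodule.add_mem _ hY hZ)
  have hYY := mul_self_mem_span_one_of_mem_selfAdjointSubmodule_inf_ker_trace_of_alt_finrank_four hB halt h4 hY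
  have hZZ := mul_self_mem_span_one_of_mem_selfAdjointSubmodule_inf_ker_trace_of_alt_finrank_four hB halt h4 hZ
  have h : Y * Z + Z * Y = (Y + Z) * (Y + Z) - Y * Y - Z * Z := by noncomm_ring
  rw [h]
  exact Submodule.sub_mem _ (Submodule.sub_mem _ hYZ hYY) hZZ

end SymplecticSmall

end Literature.Algebra.Lie
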